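import Mathlib
import Literature.MathematicalPhysics.QuantumFieldTheory.MagnenRivasseauSeneor1993.MRS93LemmaVI2FeynmanGauge
import HarnessLib

/-!
# Magnen–Rivasseau–Sénéor, *Construction of YM₄ with an infrared cutoff* (CMP 155, 1993), §VI (VI.17): the first order in `β` of
# `−½⟨ln det BF⟩` for EVERY gauge parameter ζ, kernel-computed «by tracing the twelve by twelve matrix (VI.9) and its square»

statement-level skeleton of published theorems with citation tags; proofs where landed; nothing here is a claim about the
Yang–Mills mass gap, about continuum YM₄ on T⁴, or about the Clay problem

**Citation header (reproduction of PUBLISHED work).** J. Magnen, V. Rivasseau, R. Sénéor, *Construction of YM₄ with an infrared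
cutoff*, Commun. Math. Phys. **155** (1993) 325–383 [MagnenRivasseauSeneor1993], Sect. VI pp.369–374 [PDF 45–50] (held scan
`paper:magnen1993-cmp155-mrs-ym4-infrared-cutoff`; page images `run/shared/lean/pub/lit-balaban/inprint/lit-balaban-p14/renders-cmp155/
p45_full_s6.png` (VI.6)–(VI.7), `p46_full_s6.png` (VI.8)–(VI.12), `p49_full_s6.png` (VI.17)). Cell pub-balaban-gaps (YM blitz, track G3), seat
mrs-lit-2 (gen 2; docfixes v1.1 gen 4, v1.2 gen 5); record `run/shared/lean/pub/pub-balaban-gaps/g3/MRS-AS-PRINTED-estimates.md` §3 finding (f); exact-arithmetic companion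
script `run/shared/lean/pub/pub-balaban-gaps/pub-balaban-gaps-mrs-lit-2/vi17_check.py`. Imports `MRS93LemmaVI2FeynmanGauge.lean` ((VI.6) `Pmat`,
the angular average `angAvg` of (VI.14)/(VI.17) and `angAvg_affine_A`) and, through it, `MRS93OneLoopCounterterms.lean` (`OneLoop.bosonFirstOrder`,
the bracket of (VI.17) as printed).

**What the paper prints (verbatim, from the page images).**
* p.370 [PDF 46] (VI.9), first line: «BF = δ_μν + ψ[(P²δ_μσ − (1 − ζ)P_μP_σ)(δ_σν + (ζ⁻¹ − 1)p_σp_ν/p²) − p²δ_μν]», with (VI.6) `P_μ`,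
  (VI.7) `Σ_μ p_μP_μ = K_FP`, (VI.8) `P²`; second line «= δ_μν[1 + ψU] + ψ(p_μp_ν/p²)V + ψW_μν» with (VI.10) `U`, (VI.11) `V`, (VI.12a–j) `W`
  (pp.370–371 [PDF 46–47]; matrices written row by row, rows separated by «;»):
  «W₀₀ = W₀₃ = W₃₀ = W₃₃ = 0, (VI.12a)», «W₀₁ = W₁₀ = −(1 − ζ)(0 0 0; 0 0 −ip₀x; 0 ip₀x 0), (VI.12b)», «W₀₂ = W₂₀ = −(1 − ζ)(0 0 ip₀y;
  0 0 0; −ip₀y 0 0), (VI.12c)», «W₁₃ = W₃₁ = −(1 − ζ)(0 0 0; 0 0 −ip₃x; 0 ip₃x 0), (VI.12d)», «W₂₃ = W₃₂ = −(1 − ζ)(0 0 ip₃y; 0 0 0;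
  −ip₃y 0 0), (VI.12e)» and «W₁₂ = (0  0  −ip₁y(1 − ζ);  xy[(1 − ζ)²/ζ · p₂²/p² − (1 − ζ)]  −x²(1 − ζ)²/ζ · p₁p₂/p²  −ip₂x(1 − 1/ζ);
  ip₁y(1 − ζ)  ip₂x(1 − 1/ζ)  −x²(1 − ζ)²/ζ · p₁p₂/p²), (VI.12g)». (Docfix v1.1, referee R8 [REF-G8] d1–d3: an earlier header misquoted
  (VI.12a), (VI.12b) and row 2 of (VI.12g); the quotes above are re-read from the page images `p46`/`p47`; no Lean statement changed.)
* p.372 [PDF 48] tl.8–10, 15–17, 18–21, 33–34 (page images `run/shared/lean/pub/pub-balaban-gaps/pub-balaban-gaps-mrs-lit-2/g5/renders/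
  p48_crop_r300-2100_s2.png`, `p48_crop_r2000-2700_s2.png`, `p48_crop_r4000-5000_s2.png`): «Remark that all these matrices are homogeneous.
  We introduce the variables u ≡ p²M⁻²ⁱ, θ and φ such that p₁² = uM²ⁱcos²θ and p₂² = uM²ⁱsin²θcos²φ. Then d⁴p is proportional to
  M⁴ⁱudu sin²θ sinφdθdφ.»; «We can suppose that y ≤ x, since the function g_{i,α,Δ} is symmetric in x and y. We put v = p²/x² = uM²ⁱ/x²,
  β = κ_k(u)/v = x²M⁻²ⁱκ_k(u)/u (β is a function of k, u and x), κ = κ_k(u) and y = tx, t ∈ [0, 1].» [text layer: «y < x»; image: «y ≤ x»];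
  «With these notations we can compute explicitly the three by three determinant (VI.13) and in principle the twelve by twelve
  determinant (VI.9) and we find (forgetting the commutator [B, B]² in (VI.1), which is positive and plays no rôle anyway):» (VI.14)
  «where P is a polynomial in all the variables listed, whose explicit computation requires the evaluation of the twelve by twelve
  determinant (VI.9).» (Docfix v1.2, referee gen 11 FINDING F-P372: the v1/v1.1 header carried at this place two sentences — «It is a
  polynomial of degree 24 in β^{1/2}x⁻¹ … variables x and y = tx» and «Remark also that all these matrices are homogeneous, so that
  factorizing p² we may assume from now on that they depend on angular variables p_μ/p» — that are NOT PRINTED anywhere in the paper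
  (text layer, all 60 pages: 0 hits for «degree 24» / «of degree», for «factorizing» and for «angular variables»; «homogeneous» occurs
  once, p.372 tl.8); they were the seat's paraphrase: the homogeneity of (VI.6)–(VI.13) in (p, x, y) jointly is what licenses the
  unit-sphere normalisation `p_μ → n_μ = p_μ/|p|` used below, and «degree 24» was the seat's own count (12 × degree 2 in (x, y)) for
  det BF. The quotes above are re-read from the page images; no Lean statement changed.)
* p.373 [PDF 49] tl.15–18: «To find the right coefficient for the counterterm and complete the proof of stability we have only to identify
  this first order term also for BF. It can be done by tracing the twelve by twelve matrix (VI.9) and its square, which is much easier than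
  computing the determinant. It gives:» (VI.17) «[(2/π)∫₀^{+π} sin²θdθ(1/2)∫₀^{+π} sinφdφ − (1/2)ln(1 + βP, κ, t, cosθ, sinφ, ζ, 1/ζ)) [sic]]
  = (β/2)(1 + t²)(−6(1 + (1/ζ − 1)/4) − 2ζ(1 + (1/ζ − 1)/4) + κ[(9/2) + (3/2)(1/ζ − 1) − 2 + (3/2)ζ]) + O(β²). (VI.17)» — the argument
  of the logarithm is PRINTED «ln(1 + βP, κ, t, …)» (image `p49`); it is read, here and below, as «ln(1 + βP(β, κ, t, cosθ, sinφ, ζ, 1/ζ))»,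
  the form the next display (VI.18) prints («− (1/2) ln(1 + βP(β, κ, t, cos θ, sin φ, ζ, 1/ζ))»). (Docfix v1.1, referee R8 [REF-G8] nit d4.)

**What this file proves (kernel-checked; numbers, not adjectives).**
* `BFm1` := the operator `BF − 1` of (VI.9) FIRST LINE, block `(μ, ν)`, on the unit momentum sphere (`p_μ → n_μ`, `P²`, `K_FP` at `p² = 1`:
  `PsqUnit`, `KFPUnit`; `w` a free name for `ζ⁻¹`); `BFm1_decomp_μν` (16 blocks): `BF − 1 = ψ(ζw − 1)n_μn_ν·1 + i·R¹_μν + R²_μν` with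
  explicit REAL blocks `BFdeg1 = R¹` (degree 1 in `(x, y)`, i.e. order `√β`) and `BFdeg2 = R²` (degree 2, order `β`); for `w = ζ⁻¹` the
  order-zero part vanishes.
* `lnDetFirstOrder := Σ_μ tr R²_μμ + ½Σ_μν tr(R¹_μν R¹_νμ)` — the first order of `tr M − ½tr M²`, `M = BF − 1` — and `lnDetFirstOrder_sphere`:
  on `n₀² + n₁² + n₂² + n₃² = 1` it equals `α(x² + y²) + γ(n₁²x² + n₂²y²)` with explicit `α, γ ∈ ℤ[ψ, ζ, w]`.
* `bosonFirstOrder_VI17` (every `ζ ≠ 0`): `−½ · angAvg(lnDetFirstOrder at w = ζ⁻¹, y = tx, n = (0, cosθ, sinθcosφ, sinθsinφ))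
  = ψx² · ½(1 + t²) · OneLoop.bosonFirstOrder ζ ψ` — i.e. (VI.17) EXACTLY AS PRINTED, with `β = ψx²` and `κ = ψ` on `|p| = 1`
  (the choice `n₀ = 0` is immaterial: by `lnDetFirstOrder_sphere` only `n₁, n₂` enter); `bosonFirstOrder_VI17_homothetic` (ζ = 3/13).
* Findings AS PRINTED vs the operator (recorded, not repaired): `BFdeg1_not_symmetric` — the first line of (VI.9) is NOT `μ ↔ ν` symmetric
  for `ζ ≠ 1` (it is a product of two symmetric factors), so «W₀₁ = W₁₀», «W₀₂ = W₂₀», «W₁₃ = W₃₁», «W₂₃ = W₃₂» (VI.12b–e) cannot all be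
  blocks of that operator (the exact companion script finds: the printed W₀₁, W₀₂, W₃₁, W₃₂ (VI.12b–e) and W₁₁ (VI.12f), W₂₁ (VI.12h),
  W₂₂ (VI.12i) agree with the operator's blocks; hence W₁₀, W₂₀, W₁₃, W₂₃ do not); `BFdeg2_12_entry21` — the entry (2,1) of `R²₁₂/ψ`
  is `xy[(1 − ζ) + ((1 − ζ)²/ζ)n₂²]`, where (VI.12g) prints «− (1 − ζ)». Taking the printed blocks (VI.10)–(VI.12) literally instead of the
  operator changes the first order by `(3/2 − (2/3)ζ⁻¹ + ζ⁻²/12 − (4/3)ζ + (5/12)ζ²)κ²(1 + t²)β` (companion script; not a Lean statement) —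
  so (VI.17) was computed from the operator, as here.

**NOT claimed.** The analytic step `ln det(1 + M) = tr M − ½tr M² + O(‖M‖³)` and the `O(β²)` remainder of (VI.17) (the paper's, p.373
tl.17); Lemma VI.2 for `ζ ≠ 1` (SKETCH of record: `P` of (VI.14) is the 12 × 12 determinant (VI.9), not computed in print — see
`MRS93LemmaVI2FeynmanGauge.lean` for ζ = 1); anything about the expansion, the infrared cutoff (fixed, never lifted), T⁴, or Bałaban's papers.
-/

namespace Literature.MathematicalPhysics.QuantumFieldTheory.MagnenRivasseauSeneor1993

namespace BosonTrace

open Complex Matrix FeynmanGauge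

/-- (VI.8) on the unit momentum sphere `p² = 1` (cf. `FeynmanGauge.sum_Pmat_sq_eq_VI8`; the normalisation is licensed by «Remark that all
these matrices are homogeneous.», p.372 tl.8 — (VI.6), (VI.7), (VI.8) are homogeneous of degrees 1, 2, 2 in `(p, x, y)` jointly):
`P² = (1+y² 0 2ip₂y; 0 1+x² −2ip₁x; −2ip₂y 2ip₁x 1+x²+y²)`. [cite: MagnenRivasseauSeneor1993, §VI (VI.8) p.370] -/
def PsqUnit (n₁ n₂ x y : ℝ) : Matrix (Fin 3) (Fin 3) ℂ :=
  !![1 + (y : ℂ) * y, 0, 2 * I * n₂ * y; 0, 1 + (x : ℂ) * x, -(2 * I * n₁ * x); -(2 * I * n₂ * y), 2 * I * n₁ * x, 1 + (x : ℂ) * x + (y : ℂ) * y]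

/-- (VI.7) on the unit momentum sphere: `Σ_σ p_σP_σ = K_FP = (1 0 ip₂y; 0 1 −ip₁x; −ip₂y ip₁x 1)` (cf. `FeynmanGauge.KFP_eq_VI7`).
[cite: MagnenRivasseauSeneor1993, §VI (VI.7) p.369] -/
def KFPUnit (n₁ n₂ x y : ℝ) : Matrix (Fin 3) (Fin 3) ℂ :=
  !![1, 0, I * n₂ * y; 0, 1, -(I * n₁ * x); -(I * n₂ * y), I * n₁ * x, 1]

/-- The unit momentum `n = p/|p| = (n₀, n₁, n₂, n₃)`; in the angles of p.372 tl.8–9 («θ and φ such that p₁² = uM²ⁱcos²θ and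
p₂² = uM²ⁱsin²θcos²φ», `u ≡ p²M⁻²ⁱ`): `n₁ = cosθ`, `n₂ = sinθcosφ`. [cite: MagnenRivasseauSeneor1993, §VI (VI.9) p.370, p.372 tl.8–9] -/
def nvec (n₀ n₁ n₂ n₃ : ℝ) : Fin 4 → ℝ := ![n₀, n₁, n₂, n₃]

/-- **`BF − 1` from (VI.9), first line** p.370 [PDF 46]: «BF = δ_μν + ψ[(P²δ_μσ − (1 − ζ)P_μP_σ)(δ_σν + (ζ⁻¹ − 1)p_σp_ν/p²) − p²δ_μν]»,
its 3 × 3 block `(μ, ν)` on the unit momentum sphere (`p_μ = n_μ`, `P_μ` = `FeynmanGauge.Pmat n₀ n₁ n₂ n₃ x y μ` of (VI.6), `P²` = `PsqUnit`,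
`Σ_σ p_σP_σ` = `KFPUnit`), with `w` standing for `ζ⁻¹` (a separate real variable; `ζw = 1` is imposed where needed); expanding the product:
`ψ[(δ_μν + (w − 1)n_μn_ν)P² − (1 − ζ)(P_μP_ν + (w − 1)n_ν P_μ(Σ_σ n_σP_σ)) − δ_μν·1]`. This operator is not symmetric under `μ ↔ ν`
(`BFdeg1_not_symmetric`). [cite: MagnenRivasseauSeneor1993, §VI (VI.9) p.370] -/
def BFm1 (ζ w ψ x y n₀ n₁ n₂ n₃ : ℝ) (μ ν : Fin 4) : Matrix (Fin 3) (Fin 3) ℂ :=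
  (ψ : ℂ) • ((((if μ = ν then (1 : ℝ) else 0) + (w - 1) * nvec n₀ n₁ n₂ n₃ μ * nvec n₀ n₁ n₂ n₃ ν : ℝ) : ℂ) • PsqUnit n₁ n₂ x y
      - ((1 - ζ : ℝ) : ℂ) • (Pmat n₀ n₁ n₂ n₃ x y μ * Pmat n₀ n₁ n₂ n₃ x y ν
          + (((w - 1) * nvec n₀ n₁ n₂ n₃ ν : ℝ) : ℂ) • (Pmat n₀ n₁ n₂ n₃ x y μ * KFPUnit n₁ n₂ x y))
      - ((if μ = ν then (1 : ℝ) else 0 : ℝ) : ℂ) • (1 : Matrix (Fin 3) (Fin 3) ℂ))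

/-- The entries of `BF − 1` ((VI.9), first line, unit sphere) of degree one in `(x, y)` (order `√β`), divided by `i` (they are purely
imaginary): the REAL 3 × 3 blocks `R¹_μν`, `(BF − 1)⁽¹⁾_μν = i·R¹_μν` (generated by the companion script from (VI.6)/(VI.9); checked against
the operator in `BFm1_decomp_μν`). [cite: MagnenRivasseauSeneor1993, §VI (VI.9) p.370] -/
def BFdeg1 (ζ w ψ x y n₀ n₁ n₂ n₃ : ℝ) : Fin 4 → Fin 4 → Matrix (Fin 3) (Fin 3) ℝ
  | 0, 0 =>
      !![0,
        0,
        2 * y * n₂ * ψ - y * n₀ * n₀ * n₂ * ψ + y * n₀ * n₀ * n₂ * ψ * w - y * n₀ * n₀ * n₂ * ψ * ζ + y * n₀ * n₀ * n₂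
          * ψ * ζ * w;
        0,
        0,
        -2 * x * n₁ * ψ + x * n₀ * n₀ * n₁ * ψ - x * n₀ * n₀ * n₁ * ψ * w + x * n₀ * n₀ * n₁ * ψ * ζ - x * n₀ * n₀ *
          n₁ * ψ * ζ * w;
        -2 * y * n₂ * ψ + y * n₀ * n₀ * n₂ * ψ - y * n₀ * n₀ * n₂ * ψ * w + y * n₀ * n₀ * n₂ * ψ * ζ - y * n₀ * n₀ *
          n₂ * ψ * ζ * w,
        2 * x * n₁ * ψ - x * n₀ * n₀ * n₁ * ψ + x * n₀ * n₀ * n₁ * ψ * w - x * n₀ * n₀ * n₁ * ψ * ζ + x * n₀ * n₀ * n₁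
          * ψ * ζ * w,
        0]
  | 0, 1 =>
      !![0,
        0,
        -y * n₀ * n₁ * n₂ * ψ + y * n₀ * n₁ * n₂ * ψ * w - y * n₀ * n₁ * n₂ * ψ * ζ + y * n₀ * n₁ * n₂ * ψ * ζ * w;
        0,
        0,
        x * n₀ * ψ - x * n₀ * ψ * ζ + x * n₀ * n₁ * n₁ * ψ - x * n₀ * n₁ * n₁ * ψ * w + x * n₀ * n₁ * n₁ * ψ * ζ - x *
          n₀ * n₁ * n₁ * ψ * ζ * w;
        y * n₀ * n₁ * n₂ * ψ - y * n₀ * n₁ * n₂ * ψ * w + y * n₀ * n₁ * n₂ * ψ * ζ - y * n₀ * n₁ * n₂ * ψ * ζ * w,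
        -x * n₀ * ψ + x * n₀ * ψ * ζ - x * n₀ * n₁ * n₁ * ψ + x * n₀ * n₁ * n₁ * ψ * w - x * n₀ * n₁ * n₁ * ψ * ζ + x
          * n₀ * n₁ * n₁ * ψ * ζ * w,
        0]
  | 0, 2 =>
      !![0,
        0,
        -y * n₀ * ψ + y * n₀ * ψ * ζ - y * n₀ * n₂ * n₂ * ψ + y * n₀ * n₂ * n₂ * ψ * w - y * n₀ * n₂ * n₂ * ψ * ζ + y
          * n₀ * n₂ * n₂ * ψ * ζ * w;
        0,
        0,
        x * n₀ * n₁ * n₂ * ψ - x * n₀ * n₁ * n₂ * ψ * w + x * n₀ * n₁ * n₂ * ψ * ζ - x * n₀ * n₁ * n₂ * ψ * ζ * w;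
        y * n₀ * ψ - y * n₀ * ψ * ζ + y * n₀ * n₂ * n₂ * ψ - y * n₀ * n₂ * n₂ * ψ * w + y * n₀ * n₂ * n₂ * ψ * ζ - y *
          n₀ * n₂ * n₂ * ψ * ζ * w,
        -x * n₀ * n₁ * n₂ * ψ + x * n₀ * n₁ * n₂ * ψ * w - x * n₀ * n₁ * n₂ * ψ * ζ + x * n₀ * n₁ * n₂ * ψ * ζ * w,
        0]
  | 0, 3 =>
      !![0,
        0,
        -y * n₀ * n₂ * n₃ * ψ + y * n₀ * n₂ * n₃ * ψ * w - y * n₀ * n₂ * n₃ * ψ * ζ + y * n₀ * n₂ * n₃ * ψ * ζ * w;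
        0,
        0,
        x * n₀ * n₁ * n₃ * ψ - x * n₀ * n₁ * n₃ * ψ * w + x * n₀ * n₁ * n₃ * ψ * ζ - x * n₀ * n₁ * n₃ * ψ * ζ * w;
        y * n₀ * n₂ * n₃ * ψ - y * n₀ * n₂ * n₃ * ψ * w + y * n₀ * n₂ * n₃ * ψ * ζ - y * n₀ * n₂ * n₃ * ψ * ζ * w,
        -x * n₀ * n₁ * n₃ * ψ + x * n₀ * n₁ * n₃ * ψ * w - x * n₀ * n₁ * n₃ * ψ * ζ + x * n₀ * n₁ * n₃ * ψ * ζ * w,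
        0]
  | 1, 0 =>
      !![0,
        0,
        -y * n₀ * n₁ * n₂ * ψ + y * n₀ * n₁ * n₂ * ψ * w - y * n₀ * n₁ * n₂ * ψ * ζ + y * n₀ * n₁ * n₂ * ψ * ζ * w;
        0,
        0,
        x * n₀ * ψ * w - x * n₀ * ψ * ζ * w + x * n₀ * n₁ * n₁ * ψ - x * n₀ * n₁ * n₁ * ψ * w + x * n₀ * n₁ * n₁ * ψ *
          ζ - x * n₀ * n₁ * n₁ * ψ * ζ * w;
        y * n₀ * n₁ * n₂ * ψ - y * n₀ * n₁ * n₂ * ψ * w + y * n₀ * n₁ * n₂ * ψ * ζ - y * n₀ * n₁ * n₂ * ψ * ζ * w,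
        -x * n₀ * ψ * w + x * n₀ * ψ * ζ * w - x * n₀ * n₁ * n₁ * ψ + x * n₀ * n₁ * n₁ * ψ * w - x * n₀ * n₁ * n₁ * ψ
          * ζ + x * n₀ * n₁ * n₁ * ψ * ζ * w,
        0]
  | 1, 1 =>
      !![0,
        0,
        2 * y * n₂ * ψ - y * n₁ * n₁ * n₂ * ψ + y * n₁ * n₁ * n₂ * ψ * w - y * n₁ * n₁ * n₂ * ψ * ζ + y * n₁ * n₁ * n₂
          * ψ * ζ * w;
        0,
        0,
        -x * n₁ * ψ + x * n₁ * ψ * w - x * n₁ * ψ * ζ - x * n₁ * ψ * ζ * w + x * n₁ * n₁ * n₁ * ψ - x * n₁ * n₁ * n₁ *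
          ψ * w + x * n₁ * n₁ * n₁ * ψ * ζ - x * n₁ * n₁ * n₁ * ψ * ζ * w;
        -2 * y * n₂ * ψ + y * n₁ * n₁ * n₂ * ψ - y * n₁ * n₁ * n₂ * ψ * w + y * n₁ * n₁ * n₂ * ψ * ζ - y * n₁ * n₁ *
          n₂ * ψ * ζ * w,
        x * n₁ * ψ - x * n₁ * ψ * w + x * n₁ * ψ * ζ + x * n₁ * ψ * ζ * w - x * n₁ * n₁ * n₁ * ψ + x * n₁ * n₁ * n₁ *
          ψ * w - x * n₁ * n₁ * n₁ * ψ * ζ + x * n₁ * n₁ * n₁ * ψ * ζ * w,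
        0]
  | 1, 2 =>
      !![0,
        0,
        -y * n₁ * ψ + y * n₁ * ψ * ζ - y * n₁ * n₂ * n₂ * ψ + y * n₁ * n₂ * n₂ * ψ * w - y * n₁ * n₂ * n₂ * ψ * ζ + y
          * n₁ * n₂ * n₂ * ψ * ζ * w;
        0,
        0,
        x * n₂ * ψ * w - x * n₂ * ψ * ζ * w + x * n₁ * n₁ * n₂ * ψ - x * n₁ * n₁ * n₂ * ψ * w + x * n₁ * n₁ * n₂ * ψ *
          ζ - x * n₁ * n₁ * n₂ * ψ * ζ * w;
        y * n₁ * ψ - y * n₁ * ψ * ζ + y * n₁ * n₂ * n₂ * ψ - y * n₁ * n₂ * n₂ * ψ * w + y * n₁ * n₂ * n₂ * ψ * ζ - y *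
          n₁ * n₂ * n₂ * ψ * ζ * w,
        -x * n₂ * ψ * w + x * n₂ * ψ * ζ * w - x * n₁ * n₁ * n₂ * ψ + x * n₁ * n₁ * n₂ * ψ * w - x * n₁ * n₁ * n₂ * ψ
          * ζ + x * n₁ * n₁ * n₂ * ψ * ζ * w,
        0]
  | 1, 3 =>
      !![0,
        0,
        -y * n₁ * n₂ * n₃ * ψ + y * n₁ * n₂ * n₃ * ψ * w - y * n₁ * n₂ * n₃ * ψ * ζ + y * n₁ * n₂ * n₃ * ψ * ζ * w;
        0,
        0,
        x * n₃ * ψ * w - x * n₃ * ψ * ζ * w + x * n₁ * n₁ * n₃ * ψ - x * n₁ * n₁ * n₃ * ψ * w + x * n₁ * n₁ * n₃ * ψ *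
          ζ - x * n₁ * n₁ * n₃ * ψ * ζ * w;
        y * n₁ * n₂ * n₃ * ψ - y * n₁ * n₂ * n₃ * ψ * w + y * n₁ * n₂ * n₃ * ψ * ζ - y * n₁ * n₂ * n₃ * ψ * ζ * w,
        -x * n₃ * ψ * w + x * n₃ * ψ * ζ * w - x * n₁ * n₁ * n₃ * ψ + x * n₁ * n₁ * n₃ * ψ * w - x * n₁ * n₁ * n₃ * ψ
          * ζ + x * n₁ * n₁ * n₃ * ψ * ζ * w,
        0]
  | 2, 0 =>
      !![0,
        0,
        -y * n₀ * ψ * w + y * n₀ * ψ * ζ * w - y * n₀ * n₂ * n₂ * ψ + y * n₀ * n₂ * n₂ * ψ * w - y * n₀ * n₂ * n₂ * ψ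
          * ζ + y * n₀ * n₂ * n₂ * ψ * ζ * w;
        0,
        0,
        x * n₀ * n₁ * n₂ * ψ - x * n₀ * n₁ * n₂ * ψ * w + x * n₀ * n₁ * n₂ * ψ * ζ - x * n₀ * n₁ * n₂ * ψ * ζ * w;
        y * n₀ * ψ * w - y * n₀ * ψ * ζ * w + y * n₀ * n₂ * n₂ * ψ - y * n₀ * n₂ * n₂ * ψ * w + y * n₀ * n₂ * n₂ * ψ *
          ζ - y * n₀ * n₂ * n₂ * ψ * ζ * w,
        -x * n₀ * n₁ * n₂ * ψ + x * n₀ * n₁ * n₂ * ψ * w - x * n₀ * n₁ * n₂ * ψ * ζ + x * n₀ * n₁ * n₂ * ψ * ζ * w,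
        0]
  | 2, 1 =>
      !![0,
        0,
        -y * n₁ * ψ * w + y * n₁ * ψ * ζ * w - y * n₁ * n₂ * n₂ * ψ + y * n₁ * n₂ * n₂ * ψ * w - y * n₁ * n₂ * n₂ * ψ
          * ζ + y * n₁ * n₂ * n₂ * ψ * ζ * w;
        0,
        0,
        x * n₂ * ψ - x * n₂ * ψ * ζ + x * n₁ * n₁ * n₂ * ψ - x * n₁ * n₁ * n₂ * ψ * w + x * n₁ * n₁ * n₂ * ψ * ζ - x *
          n₁ * n₁ * n₂ * ψ * ζ * w;
        y * n₁ * ψ * w - y * n₁ * ψ * ζ * w + y * n₁ * n₂ * n₂ * ψ - y * n₁ * n₂ * n₂ * ψ * w + y * n₁ * n₂ * n₂ * ψ *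
          ζ - y * n₁ * n₂ * n₂ * ψ * ζ * w,
        -x * n₂ * ψ + x * n₂ * ψ * ζ - x * n₁ * n₁ * n₂ * ψ + x * n₁ * n₁ * n₂ * ψ * w - x * n₁ * n₁ * n₂ * ψ * ζ + x
          * n₁ * n₁ * n₂ * ψ * ζ * w,
        0]
  | 2, 2 =>
      !![0,
        0,
        y * n₂ * ψ - y * n₂ * ψ * w + y * n₂ * ψ * ζ + y * n₂ * ψ * ζ * w - y * n₂ * n₂ * n₂ * ψ + y * n₂ * n₂ * n₂ *
          ψ * w - y * n₂ * n₂ * n₂ * ψ * ζ + y * n₂ * n₂ * n₂ * ψ * ζ * w;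
        0,
        0,
        -2 * x * n₁ * ψ + x * n₁ * n₂ * n₂ * ψ - x * n₁ * n₂ * n₂ * ψ * w + x * n₁ * n₂ * n₂ * ψ * ζ - x * n₁ * n₂ *
          n₂ * ψ * ζ * w;
        -y * n₂ * ψ + y * n₂ * ψ * w - y * n₂ * ψ * ζ - y * n₂ * ψ * ζ * w + y * n₂ * n₂ * n₂ * ψ - y * n₂ * n₂ * n₂ *
          ψ * w + y * n₂ * n₂ * n₂ * ψ * ζ - y * n₂ * n₂ * n₂ * ψ * ζ * w,
        2 * x * n₁ * ψ - x * n₁ * n₂ * n₂ * ψ + x * n₁ * n₂ * n₂ * ψ * w - x * n₁ * n₂ * n₂ * ψ * ζ + x * n₁ * n₂ * n₂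
          * ψ * ζ * w,
        0]
  | 2, 3 =>
      !![0,
        0,
        -y * n₃ * ψ * w + y * n₃ * ψ * ζ * w - y * n₂ * n₂ * n₃ * ψ + y * n₂ * n₂ * n₃ * ψ * w - y * n₂ * n₂ * n₃ * ψ
          * ζ + y * n₂ * n₂ * n₃ * ψ * ζ * w;
        0,
        0,
        x * n₁ * n₂ * n₃ * ψ - x * n₁ * n₂ * n₃ * ψ * w + x * n₁ * n₂ * n₃ * ψ * ζ - x * n₁ * n₂ * n₃ * ψ * ζ * w;
        y * n₃ * ψ * w - y * n₃ * ψ * ζ * w + y * n₂ * n₂ * n₃ * ψ - y * n₂ * n₂ * n₃ * ψ * w + y * n₂ * n₂ * n₃ * ψ *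
          ζ - y * n₂ * n₂ * n₃ * ψ * ζ * w,
        -x * n₁ * n₂ * n₃ * ψ + x * n₁ * n₂ * n₃ * ψ * w - x * n₁ * n₂ * n₃ * ψ * ζ + x * n₁ * n₂ * n₃ * ψ * ζ * w,
        0]
  | 3, 0 =>
      !![0,
        0,
        -y * n₀ * n₂ * n₃ * ψ + y * n₀ * n₂ * n₃ * ψ * w - y * n₀ * n₂ * n₃ * ψ * ζ + y * n₀ * n₂ * n₃ * ψ * ζ * w;
        0,
        0,
        x * n₀ * n₁ * n₃ * ψ - x * n₀ * n₁ * n₃ * ψ * w + x * n₀ * n₁ * n₃ * ψ * ζ - x * n₀ * n₁ * n₃ * ψ * ζ * w;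
        y * n₀ * n₂ * n₃ * ψ - y * n₀ * n₂ * n₃ * ψ * w + y * n₀ * n₂ * n₃ * ψ * ζ - y * n₀ * n₂ * n₃ * ψ * ζ * w,
        -x * n₀ * n₁ * n₃ * ψ + x * n₀ * n₁ * n₃ * ψ * w - x * n₀ * n₁ * n₃ * ψ * ζ + x * n₀ * n₁ * n₃ * ψ * ζ * w,
        0]
  | 3, 1 =>
      !![0,
        0,
        -y * n₁ * n₂ * n₃ * ψ + y * n₁ * n₂ * n₃ * ψ * w - y * n₁ * n₂ * n₃ * ψ * ζ + y * n₁ * n₂ * n₃ * ψ * ζ * w;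
        0,
        0,
        x * n₃ * ψ - x * n₃ * ψ * ζ + x * n₁ * n₁ * n₃ * ψ - x * n₁ * n₁ * n₃ * ψ * w + x * n₁ * n₁ * n₃ * ψ * ζ - x *
          n₁ * n₁ * n₃ * ψ * ζ * w;
        y * n₁ * n₂ * n₃ * ψ - y * n₁ * n₂ * n₃ * ψ * w + y * n₁ * n₂ * n₃ * ψ * ζ - y * n₁ * n₂ * n₃ * ψ * ζ * w,
        -x * n₃ * ψ + x * n₃ * ψ * ζ - x * n₁ * n₁ * n₃ * ψ + x * n₁ * n₁ * n₃ * ψ * w - x * n₁ * n₁ * n₃ * ψ * ζ + x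
          * n₁ * n₁ * n₃ * ψ * ζ * w,
        0]
  | 3, 2 =>
      !![0,
        0,
        -y * n₃ * ψ + y * n₃ * ψ * ζ - y * n₂ * n₂ * n₃ * ψ + y * n₂ * n₂ * n₃ * ψ * w - y * n₂ * n₂ * n₃ * ψ * ζ + y
          * n₂ * n₂ * n₃ * ψ * ζ * w;
        0,
        0,
        x * n₁ * n₂ * n₃ * ψ - x * n₁ * n₂ * n₃ * ψ * w + x * n₁ * n₂ * n₃ * ψ * ζ - x * n₁ * n₂ * n₃ * ψ * ζ * w;
        y * n₃ * ψ - y * n₃ * ψ * ζ + y * n₂ * n₂ * n₃ * ψ - y * n₂ * n₂ * n₃ * ψ * w + y * n₂ * n₂ * n₃ * ψ * ζ - y *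
          n₂ * n₂ * n₃ * ψ * ζ * w,
        -x * n₁ * n₂ * n₃ * ψ + x * n₁ * n₂ * n₃ * ψ * w - x * n₁ * n₂ * n₃ * ψ * ζ + x * n₁ * n₂ * n₃ * ψ * ζ * w,
        0]
  | 3, 3 =>
      !![0,
        0,
        2 * y * n₂ * ψ - y * n₂ * n₃ * n₃ * ψ + y * n₂ * n₃ * n₃ * ψ * w - y * n₂ * n₃ * n₃ * ψ * ζ + y * n₂ * n₃ * n₃
          * ψ * ζ * w;
        0,
        0,
        -2 * x * n₁ * ψ + x * n₁ * n₃ * n₃ * ψ - x * n₁ * n₃ * n₃ * ψ * w + x * n₁ * n₃ * n₃ * ψ * ζ - x * n₁ * n₃ *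
          n₃ * ψ * ζ * w;
        -2 * y * n₂ * ψ + y * n₂ * n₃ * n₃ * ψ - y * n₂ * n₃ * n₃ * ψ * w + y * n₂ * n₃ * n₃ * ψ * ζ - y * n₂ * n₃ *
          n₃ * ψ * ζ * w,
        2 * x * n₁ * ψ - x * n₁ * n₃ * n₃ * ψ + x * n₁ * n₃ * n₃ * ψ * w - x * n₁ * n₃ * n₃ * ψ * ζ + x * n₁ * n₃ * n₃
          * ψ * ζ * w,
        0]

/-- The entries of `BF − 1` ((VI.9), first line, unit sphere) of degree two in `(x, y)` (order `β`): the REAL 3 × 3 blocks `R²_μν`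
(generated; checked in `BFm1_decomp_μν`). [cite: MagnenRivasseauSeneor1993, §VI (VI.9) p.370] -/
def BFdeg2 (ζ w ψ x y n₀ n₁ n₂ n₃ : ℝ) : Fin 4 → Fin 4 → Matrix (Fin 3) (Fin 3) ℝ
  | 0, 0 =>
      !![y * y * ψ - y * y * n₀ * n₀ * ψ + y * y * n₀ * n₀ * ψ * w,
        0,
        0;
        0,
        x * x * ψ - x * x * n₀ * n₀ * ψ + x * x * n₀ * n₀ * ψ * w,
        0;
        0,
        0,
        y * y * ψ - y * y * n₀ * n₀ * ψ + y * y * n₀ * n₀ * ψ * w + x * x * ψ - x * x * n₀ * n₀ * ψ + x * x * n₀ * n₀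
          * ψ * w]
  | 0, 1 =>
      !![-y * y * n₀ * n₁ * ψ + y * y * n₀ * n₁ * ψ * w,
        0,
        0;
        0,
        -x * x * n₀ * n₁ * ψ + x * x * n₀ * n₁ * ψ * w,
        0;
        0,
        0,
        -y * y * n₀ * n₁ * ψ + y * y * n₀ * n₁ * ψ * w - x * x * n₀ * n₁ * ψ + x * x * n₀ * n₁ * ψ * w]
  | 0, 2 =>
      !![-y * y * n₀ * n₂ * ψ + y * y * n₀ * n₂ * ψ * w,
        0,
        0;
        0,
        -x * x * n₀ * n₂ * ψ + x * x * n₀ * n₂ * ψ * w,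
        0;
        0,
        0,
        -y * y * n₀ * n₂ * ψ + y * y * n₀ * n₂ * ψ * w - x * x * n₀ * n₂ * ψ + x * x * n₀ * n₂ * ψ * w]
  | 0, 3 =>
      !![-y * y * n₀ * n₃ * ψ + y * y * n₀ * n₃ * ψ * w,
        0,
        0;
        0,
        -x * x * n₀ * n₃ * ψ + x * x * n₀ * n₃ * ψ * w,
        0;
        0,
        0,
        -y * y * n₀ * n₃ * ψ + y * y * n₀ * n₃ * ψ * w - x * x * n₀ * n₃ * ψ + x * x * n₀ * n₃ * ψ * w]
  | 1, 0 =>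
      !![-y * y * n₀ * n₁ * ψ + y * y * n₀ * n₁ * ψ * w,
        0,
        0;
        -x * y * n₀ * n₂ * ψ + x * y * n₀ * n₂ * ψ * w + x * y * n₀ * n₂ * ψ * ζ - x * y * n₀ * n₂ * ψ * ζ * w,
        -x * x * n₀ * n₁ * ψ * ζ + x * x * n₀ * n₁ * ψ * ζ * w,
        0;
        0,
        0,
        -y * y * n₀ * n₁ * ψ + y * y * n₀ * n₁ * ψ * w - x * x * n₀ * n₁ * ψ * ζ + x * x * n₀ * n₁ * ψ * ζ * w]
  | 1, 1 =>
      !![y * y * ψ - y * y * n₁ * n₁ * ψ + y * y * n₁ * n₁ * ψ * w,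
        0,
        0;
        -x * y * n₁ * n₂ * ψ + x * y * n₁ * n₂ * ψ * w + x * y * n₁ * n₂ * ψ * ζ - x * y * n₁ * n₂ * ψ * ζ * w,
        x * x * ψ * ζ - x * x * n₁ * n₁ * ψ * ζ + x * x * n₁ * n₁ * ψ * ζ * w,
        0;
        0,
        0,
        y * y * ψ - y * y * n₁ * n₁ * ψ + y * y * n₁ * n₁ * ψ * w + x * x * ψ * ζ - x * x * n₁ * n₁ * ψ * ζ + x * x *
          n₁ * n₁ * ψ * ζ * w]
  | 1, 2 =>
      !![-y * y * n₁ * n₂ * ψ + y * y * n₁ * n₂ * ψ * w,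
        0,
        0;
        x * y * ψ - x * y * ψ * ζ - x * y * n₂ * n₂ * ψ + x * y * n₂ * n₂ * ψ * w + x * y * n₂ * n₂ * ψ * ζ - x * y *
          n₂ * n₂ * ψ * ζ * w,
        -x * x * n₁ * n₂ * ψ * ζ + x * x * n₁ * n₂ * ψ * ζ * w,
        0;
        0,
        0,
        -y * y * n₁ * n₂ * ψ + y * y * n₁ * n₂ * ψ * w - x * x * n₁ * n₂ * ψ * ζ + x * x * n₁ * n₂ * ψ * ζ * w]
  | 1, 3 =>
      !![-y * y * n₁ * n₃ * ψ + y * y * n₁ * n₃ * ψ * w,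
        0,
        0;
        -x * y * n₂ * n₃ * ψ + x * y * n₂ * n₃ * ψ * w + x * y * n₂ * n₃ * ψ * ζ - x * y * n₂ * n₃ * ψ * ζ * w,
        -x * x * n₁ * n₃ * ψ * ζ + x * x * n₁ * n₃ * ψ * ζ * w,
        0;
        0,
        0,
        -y * y * n₁ * n₃ * ψ + y * y * n₁ * n₃ * ψ * w - x * x * n₁ * n₃ * ψ * ζ + x * x * n₁ * n₃ * ψ * ζ * w]
  | 2, 0 =>
      !![-y * y * n₀ * n₂ * ψ * ζ + y * y * n₀ * n₂ * ψ * ζ * w,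
        -x * y * n₀ * n₁ * ψ + x * y * n₀ * n₁ * ψ * w + x * y * n₀ * n₁ * ψ * ζ - x * y * n₀ * n₁ * ψ * ζ * w,
        0;
        0,
        -x * x * n₀ * n₂ * ψ + x * x * n₀ * n₂ * ψ * w,
        0;
        0,
        0,
        -y * y * n₀ * n₂ * ψ * ζ + y * y * n₀ * n₂ * ψ * ζ * w - x * x * n₀ * n₂ * ψ + x * x * n₀ * n₂ * ψ * w]
  | 2, 1 =>
      !![-y * y * n₁ * n₂ * ψ * ζ + y * y * n₁ * n₂ * ψ * ζ * w,
        x * y * ψ - x * y * ψ * ζ - x * y * n₁ * n₁ * ψ + x * y * n₁ * n₁ * ψ * w + x * y * n₁ * n₁ * ψ * ζ - x * y *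
          n₁ * n₁ * ψ * ζ * w,
        0;
        0,
        -x * x * n₁ * n₂ * ψ + x * x * n₁ * n₂ * ψ * w,
        0;
        0,
        0,
        -y * y * n₁ * n₂ * ψ * ζ + y * y * n₁ * n₂ * ψ * ζ * w - x * x * n₁ * n₂ * ψ + x * x * n₁ * n₂ * ψ * w]
  | 2, 2 =>
      !![y * y * ψ * ζ - y * y * n₂ * n₂ * ψ * ζ + y * y * n₂ * n₂ * ψ * ζ * w,
        -x * y * n₁ * n₂ * ψ + x * y * n₁ * n₂ * ψ * w + x * y * n₁ * n₂ * ψ * ζ - x * y * n₁ * n₂ * ψ * ζ * w,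
        0;
        0,
        x * x * ψ - x * x * n₂ * n₂ * ψ + x * x * n₂ * n₂ * ψ * w,
        0;
        0,
        0,
        y * y * ψ * ζ - y * y * n₂ * n₂ * ψ * ζ + y * y * n₂ * n₂ * ψ * ζ * w + x * x * ψ - x * x * n₂ * n₂ * ψ + x *
          x * n₂ * n₂ * ψ * w]
  | 2, 3 =>
      !![-y * y * n₂ * n₃ * ψ * ζ + y * y * n₂ * n₃ * ψ * ζ * w,
        -x * y * n₁ * n₃ * ψ + x * y * n₁ * n₃ * ψ * w + x * y * n₁ * n₃ * ψ * ζ - x * y * n₁ * n₃ * ψ * ζ * w,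
        0;
        0,
        -x * x * n₂ * n₃ * ψ + x * x * n₂ * n₃ * ψ * w,
        0;
        0,
        0,
        -y * y * n₂ * n₃ * ψ * ζ + y * y * n₂ * n₃ * ψ * ζ * w - x * x * n₂ * n₃ * ψ + x * x * n₂ * n₃ * ψ * w]
  | 3, 0 =>
      !![-y * y * n₀ * n₃ * ψ + y * y * n₀ * n₃ * ψ * w,
        0,
        0;
        0,
        -x * x * n₀ * n₃ * ψ + x * x * n₀ * n₃ * ψ * w,
        0;
        0,
        0,
        -y * y * n₀ * n₃ * ψ + y * y * n₀ * n₃ * ψ * w - x * x * n₀ * n₃ * ψ + x * x * n₀ * n₃ * ψ * w]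
  | 3, 1 =>
      !![-y * y * n₁ * n₃ * ψ + y * y * n₁ * n₃ * ψ * w,
        0,
        0;
        0,
        -x * x * n₁ * n₃ * ψ + x * x * n₁ * n₃ * ψ * w,
        0;
        0,
        0,
        -y * y * n₁ * n₃ * ψ + y * y * n₁ * n₃ * ψ * w - x * x * n₁ * n₃ * ψ + x * x * n₁ * n₃ * ψ * w]
  | 3, 2 =>
      !![-y * y * n₂ * n₃ * ψ + y * y * n₂ * n₃ * ψ * w,
        0,
        0;
        0,
        -x * x * n₂ * n₃ * ψ + x * x * n₂ * n₃ * ψ * w,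
        0;
        0,
        0,
        -y * y * n₂ * n₃ * ψ + y * y * n₂ * n₃ * ψ * w - x * x * n₂ * n₃ * ψ + x * x * n₂ * n₃ * ψ * w]
  | 3, 3 =>
      !![y * y * ψ - y * y * n₃ * n₃ * ψ + y * y * n₃ * n₃ * ψ * w,
        0,
        0;
        0,
        x * x * ψ - x * x * n₃ * n₃ * ψ + x * x * n₃ * n₃ * ψ * w,
        0;
        0,
        0,
        y * y * ψ - y * y * n₃ * n₃ * ψ + y * y * n₃ * n₃ * ψ * w + x * x * ψ - x * x * n₃ * n₃ * ψ + x * x * n₃ * n₃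
          * ψ * w]

/-- The order-`√β` part has traceless diagonal blocks: `tr R¹_μμ = 0` — so `tr(BF − 1)` starts at order `β` (with `tr R²`), and the
first order of `tr M − ½tr M²` is `tr R² + ½tr(R¹R¹)` (`lnDetFirstOrder`). [cite: MagnenRivasseauSeneor1993, §VI (VI.9), (VI.17) pp.370, 373] -/
theorem BFdeg1_trace_diag (ζ w ψ x y n₀ n₁ n₂ n₃ : ℝ) (μ : Fin 4) : Matrix.trace (BFdeg1 ζ w ψ x y n₀ n₁ n₂ n₃ μ μ) = 0 := by
  fin_cases μ <;> simp [BFdeg1, Matrix.trace_fin_three]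

/-- Block `(0,0)` of `BF − 1` ((VI.9), first line, unit sphere) = `ψ(ζw − 1)n_0n_0·1 + i·R¹_{00} + R²_{00}`. [cite: MagnenRivasseauSeneor1993, §VI (VI.9) p.370] -/
theorem BFm1_decomp_00 (ζ w ψ x y n₀ n₁ n₂ n₃ : ℝ) :
    BFm1 ζ w ψ x y n₀ n₁ n₂ n₃ 0 0 =
      ((ψ * (ζ * w - 1) * nvec n₀ n₁ n₂ n₃ 0 * nvec n₀ n₁ n₂ n₃ 0 : ℝ) : ℂ) • (1 : Matrix (Fin 3) (Fin 3) ℂ) +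
        I • (BFdeg1 ζ w ψ x y n₀ n₁ n₂ n₃ 0 0).map ((↑) : ℝ → ℂ) + (BFdeg2 ζ w ψ x y n₀ n₁ n₂ n₃ 0 0).map ((↑) : ℝ → ℂ) := by
  ext i j
  fin_cases i <;> fin_cases j <;> simp [BFm1, PsqUnit, KFPUnit, Pmat, nvec, BFdeg1, BFdeg2] <;> ring

/-- Block `(0,1)` of `BF − 1` ((VI.9), first line, unit sphere) = `ψ(ζw − 1)n_0n_1·1 + i·R¹_{01} + R²_{01}`. [cite: MagnenRivasseauSeneor1993, §VI (VI.9) p.370] -/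
theorem BFm1_decomp_01 (ζ w ψ x y n₀ n₁ n₂ n₃ : ℝ) :
    BFm1 ζ w ψ x y n₀ n₁ n₂ n₃ 0 1 =
      ((ψ * (ζ * w - 1) * nvec n₀ n₁ n₂ n₃ 0 * nvec n₀ n₁ n₂ n₃ 1 : ℝ) : ℂ) • (1 : Matrix (Fin 3) (Fin 3) ℂ) +
        I • (BFdeg1 ζ w ψ x y n₀ n₁ n₂ n₃ 0 1).map ((↑) : ℝ → ℂ) + (BFdeg2 ζ w ψ x y n₀ n₁ n₂ n₃ 0 1).map ((↑) : ℝ → ℂ) := by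
  ext i j
  fin_cases i <;> fin_cases j <;> simp [BFm1, PsqUnit, KFPUnit, Pmat, nvec, BFdeg1, BFdeg2] <;> ring

/-- Block `(0,2)` of `BF − 1` ((VI.9), first line, unit sphere) = `ψ(ζw − 1)n_0n_2·1 + i·R¹_{02} + R²_{02}`. [cite: MagnenRivasseauSeneor1993, §VI (VI.9) p.370] -/
theorem BFm1_decomp_02 (ζ w ψ x y n₀ n₁ n₂ n₃ : ℝ) :
    BFm1 ζ w ψ x y n₀ n₁ n₂ n₃ 0 2 =
      ((ψ * (ζ * w - 1) * nvec n₀ n₁ n₂ n₃ 0 * nvec n₀ n₁ n₂ n₃ 2 : ℝ) : ℂ) • (1 : Matrix (Fin 3) (Fin 3) ℂ) +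
        I • (BFdeg1 ζ w ψ x y n₀ n₁ n₂ n₃ 0 2).map ((↑) : ℝ → ℂ) + (BFdeg2 ζ w ψ x y n₀ n₁ n₂ n₃ 0 2).map ((↑) : ℝ → ℂ) := by
  ext i j
  fin_cases i <;> fin_cases j <;> simp [BFm1, PsqUnit, KFPUnit, Pmat, nvec, BFdeg1, BFdeg2] <;> ring

/-- Block `(0,3)` of `BF − 1` ((VI.9), first line, unit sphere) = `ψ(ζw − 1)n_0n_3·1 + i·R¹_{03} + R²_{03}`. [cite: MagnenRivasseauSeneor1993, §VI (VI.9) p.370] -/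
theorem BFm1_decomp_03 (ζ w ψ x y n₀ n₁ n₂ n₃ : ℝ) :
    BFm1 ζ w ψ x y n₀ n₁ n₂ n₃ 0 3 =
      ((ψ * (ζ * w - 1) * nvec n₀ n₁ n₂ n₃ 0 * nvec n₀ n₁ n₂ n₃ 3 : ℝ) : ℂ) • (1 : Matrix (Fin 3) (Fin 3) ℂ) +
        I • (BFdeg1 ζ w ψ x y n₀ n₁ n₂ n₃ 0 3).map ((↑) : ℝ → ℂ) + (BFdeg2 ζ w ψ x y n₀ n₁ n₂ n₃ 0 3).map ((↑) : ℝ → ℂ) := by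
  ext i j
  fin_cases i <;> fin_cases j <;> simp [BFm1, PsqUnit, KFPUnit, Pmat, nvec, BFdeg1, BFdeg2] <;> ring

/-- Block `(1,0)` of `BF − 1` ((VI.9), first line, unit sphere) = `ψ(ζw − 1)n_1n_0·1 + i·R¹_{10} + R²_{10}`. [cite: MagnenRivasseauSeneor1993, §VI (VI.9) p.370] -/
theorem BFm1_decomp_10 (ζ w ψ x y n₀ n₁ n₂ n₃ : ℝ) :
    BFm1 ζ w ψ x y n₀ n₁ n₂ n₃ 1 0 =
      ((ψ * (ζ * w - 1) * nvec n₀ n₁ n₂ n₃ 1 * nvec n₀ n₁ n₂ n₃ 0 : ℝ) : ℂ) • (1 : Matrix (Fin 3) (Fin 3) ℂ) +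
        I • (BFdeg1 ζ w ψ x y n₀ n₁ n₂ n₃ 1 0).map ((↑) : ℝ → ℂ) + (BFdeg2 ζ w ψ x y n₀ n₁ n₂ n₃ 1 0).map ((↑) : ℝ → ℂ) := by
  ext i j
  fin_cases i <;> fin_cases j <;> simp [BFm1, PsqUnit, KFPUnit, Pmat, nvec, BFdeg1, BFdeg2] <;> ring_nf <;>
    simp only [Complex.I_sq] <;> ring

/-- Block `(1,1)` of `BF − 1` ((VI.9), first line, unit sphere) = `ψ(ζw − 1)n_1n_1·1 + i·R¹_{11} + R²_{11}`. [cite: MagnenRivasseauSeneor1993, §VI (VI.9) p.370] -/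
theorem BFm1_decomp_11 (ζ w ψ x y n₀ n₁ n₂ n₃ : ℝ) :
    BFm1 ζ w ψ x y n₀ n₁ n₂ n₃ 1 1 =
      ((ψ * (ζ * w - 1) * nvec n₀ n₁ n₂ n₃ 1 * nvec n₀ n₁ n₂ n₃ 1 : ℝ) : ℂ) • (1 : Matrix (Fin 3) (Fin 3) ℂ) +
        I • (BFdeg1 ζ w ψ x y n₀ n₁ n₂ n₃ 1 1).map ((↑) : ℝ → ℂ) + (BFdeg2 ζ w ψ x y n₀ n₁ n₂ n₃ 1 1).map ((↑) : ℝ → ℂ) := by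
  ext i j
  fin_cases i <;> fin_cases j <;> simp [BFm1, PsqUnit, KFPUnit, Pmat, nvec, BFdeg1, BFdeg2] <;> ring_nf <;>
    simp only [Complex.I_sq] <;> ring

/-- Block `(1,2)` of `BF − 1` ((VI.9), first line, unit sphere) = `ψ(ζw − 1)n_1n_2·1 + i·R¹_{12} + R²_{12}`. [cite: MagnenRivasseauSeneor1993, §VI (VI.9) p.370] -/
theorem BFm1_decomp_12 (ζ w ψ x y n₀ n₁ n₂ n₃ : ℝ) :
    BFm1 ζ w ψ x y n₀ n₁ n₂ n₃ 1 2 =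
      ((ψ * (ζ * w - 1) * nvec n₀ n₁ n₂ n₃ 1 * nvec n₀ n₁ n₂ n₃ 2 : ℝ) : ℂ) • (1 : Matrix (Fin 3) (Fin 3) ℂ) +
        I • (BFdeg1 ζ w ψ x y n₀ n₁ n₂ n₃ 1 2).map ((↑) : ℝ → ℂ) + (BFdeg2 ζ w ψ x y n₀ n₁ n₂ n₃ 1 2).map ((↑) : ℝ → ℂ) := by
  ext i j
  fin_cases i <;> fin_cases j <;> simp [BFm1, PsqUnit, KFPUnit, Pmat, nvec, BFdeg1, BFdeg2] <;> ring_nf <;>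
    simp only [Complex.I_sq] <;> ring

/-- Block `(1,3)` of `BF − 1` ((VI.9), first line, unit sphere) = `ψ(ζw − 1)n_1n_3·1 + i·R¹_{13} + R²_{13}`. [cite: MagnenRivasseauSeneor1993, §VI (VI.9) p.370] -/
theorem BFm1_decomp_13 (ζ w ψ x y n₀ n₁ n₂ n₃ : ℝ) :
    BFm1 ζ w ψ x y n₀ n₁ n₂ n₃ 1 3 =
      ((ψ * (ζ * w - 1) * nvec n₀ n₁ n₂ n₃ 1 * nvec n₀ n₁ n₂ n₃ 3 : ℝ) : ℂ) • (1 : Matrix (Fin 3) (Fin 3) ℂ) +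
        I • (BFdeg1 ζ w ψ x y n₀ n₁ n₂ n₃ 1 3).map ((↑) : ℝ → ℂ) + (BFdeg2 ζ w ψ x y n₀ n₁ n₂ n₃ 1 3).map ((↑) : ℝ → ℂ) := by
  ext i j
  fin_cases i <;> fin_cases j <;> simp [BFm1, PsqUnit, KFPUnit, Pmat, nvec, BFdeg1, BFdeg2] <;> ring_nf <;>
    simp only [Complex.I_sq] <;> ring

/-- Block `(2,0)` of `BF − 1` ((VI.9), first line, unit sphere) = `ψ(ζw − 1)n_2n_0·1 + i·R¹_{20} + R²_{20}`. [cite: MagnenRivasseauSeneor1993, §VI (VI.9) p.370] -/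
theorem BFm1_decomp_20 (ζ w ψ x y n₀ n₁ n₂ n₃ : ℝ) :
    BFm1 ζ w ψ x y n₀ n₁ n₂ n₃ 2 0 =
      ((ψ * (ζ * w - 1) * nvec n₀ n₁ n₂ n₃ 2 * nvec n₀ n₁ n₂ n₃ 0 : ℝ) : ℂ) • (1 : Matrix (Fin 3) (Fin 3) ℂ) +
        I • (BFdeg1 ζ w ψ x y n₀ n₁ n₂ n₃ 2 0).map ((↑) : ℝ → ℂ) + (BFdeg2 ζ w ψ x y n₀ n₁ n₂ n₃ 2 0).map ((↑) : ℝ → ℂ) := by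
  ext i j
  fin_cases i <;> fin_cases j <;> simp [BFm1, PsqUnit, KFPUnit, Pmat, nvec, BFdeg1, BFdeg2] <;> ring_nf <;>
    simp only [Complex.I_sq] <;> ring

/-- Block `(2,1)` of `BF − 1` ((VI.9), first line, unit sphere) = `ψ(ζw − 1)n_2n_1·1 + i·R¹_{21} + R²_{21}`. [cite: MagnenRivasseauSeneor1993, §VI (VI.9) p.370] -/
theorem BFm1_decomp_21 (ζ w ψ x y n₀ n₁ n₂ n₃ : ℝ) :
    BFm1 ζ w ψ x y n₀ n₁ n₂ n₃ 2 1 =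
      ((ψ * (ζ * w - 1) * nvec n₀ n₁ n₂ n₃ 2 * nvec n₀ n₁ n₂ n₃ 1 : ℝ) : ℂ) • (1 : Matrix (Fin 3) (Fin 3) ℂ) +
        I • (BFdeg1 ζ w ψ x y n₀ n₁ n₂ n₃ 2 1).map ((↑) : ℝ → ℂ) + (BFdeg2 ζ w ψ x y n₀ n₁ n₂ n₃ 2 1).map ((↑) : ℝ → ℂ) := by
  ext i j
  fin_cases i <;> fin_cases j <;> simp [BFm1, PsqUnit, KFPUnit, Pmat, nvec, BFdeg1, BFdeg2] <;> ring_nf <;>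
    simp only [Complex.I_sq] <;> ring

/-- Block `(2,2)` of `BF − 1` ((VI.9), first line, unit sphere) = `ψ(ζw − 1)n_2n_2·1 + i·R¹_{22} + R²_{22}`. [cite: MagnenRivasseauSeneor1993, §VI (VI.9) p.370] -/
theorem BFm1_decomp_22 (ζ w ψ x y n₀ n₁ n₂ n₃ : ℝ) :
    BFm1 ζ w ψ x y n₀ n₁ n₂ n₃ 2 2 =
      ((ψ * (ζ * w - 1) * nvec n₀ n₁ n₂ n₃ 2 * nvec n₀ n₁ n₂ n₃ 2 : ℝ) : ℂ) • (1 : Matrix (Fin 3) (Fin 3) ℂ) +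
        I • (BFdeg1 ζ w ψ x y n₀ n₁ n₂ n₃ 2 2).map ((↑) : ℝ → ℂ) + (BFdeg2 ζ w ψ x y n₀ n₁ n₂ n₃ 2 2).map ((↑) : ℝ → ℂ) := by
  ext i j
  fin_cases i <;> fin_cases j <;> simp [BFm1, PsqUnit, KFPUnit, Pmat, nvec, BFdeg1, BFdeg2] <;> ring_nf <;>
    simp only [Complex.I_sq] <;> ring

/-- Block `(2,3)` of `BF − 1` ((VI.9), first line, unit sphere) = `ψ(ζw − 1)n_2n_3·1 + i·R¹_{23} + R²_{23}`. [cite: MagnenRivasseauSeneor1993, §VI (VI.9) p.370] -/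
theorem BFm1_decomp_23 (ζ w ψ x y n₀ n₁ n₂ n₃ : ℝ) :
    BFm1 ζ w ψ x y n₀ n₁ n₂ n₃ 2 3 =
      ((ψ * (ζ * w - 1) * nvec n₀ n₁ n₂ n₃ 2 * nvec n₀ n₁ n₂ n₃ 3 : ℝ) : ℂ) • (1 : Matrix (Fin 3) (Fin 3) ℂ) +
        I • (BFdeg1 ζ w ψ x y n₀ n₁ n₂ n₃ 2 3).map ((↑) : ℝ → ℂ) + (BFdeg2 ζ w ψ x y n₀ n₁ n₂ n₃ 2 3).map ((↑) : ℝ → ℂ) := by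
  ext i j
  fin_cases i <;> fin_cases j <;> simp [BFm1, PsqUnit, KFPUnit, Pmat, nvec, BFdeg1, BFdeg2] <;> ring_nf <;>
    simp only [Complex.I_sq] <;> ring

/-- Block `(3,0)` of `BF − 1` ((VI.9), first line, unit sphere) = `ψ(ζw − 1)n_3n_0·1 + i·R¹_{30} + R²_{30}`. [cite: MagnenRivasseauSeneor1993, §VI (VI.9) p.370] -/
theorem BFm1_decomp_30 (ζ w ψ x y n₀ n₁ n₂ n₃ : ℝ) :
    BFm1 ζ w ψ x y n₀ n₁ n₂ n₃ 3 0 =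
      ((ψ * (ζ * w - 1) * nvec n₀ n₁ n₂ n₃ 3 * nvec n₀ n₁ n₂ n₃ 0 : ℝ) : ℂ) • (1 : Matrix (Fin 3) (Fin 3) ℂ) +
        I • (BFdeg1 ζ w ψ x y n₀ n₁ n₂ n₃ 3 0).map ((↑) : ℝ → ℂ) + (BFdeg2 ζ w ψ x y n₀ n₁ n₂ n₃ 3 0).map ((↑) : ℝ → ℂ) := by
  ext i j
  fin_cases i <;> fin_cases j <;> simp [BFm1, PsqUnit, KFPUnit, Pmat, nvec, BFdeg1, BFdeg2] <;> ring

/-- Block `(3,1)` of `BF − 1` ((VI.9), first line, unit sphere) = `ψ(ζw − 1)n_3n_1·1 + i·R¹_{31} + R²_{31}`. [cite: MagnenRivasseauSeneor1993, §VI (VI.9) p.370] -/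
theorem BFm1_decomp_31 (ζ w ψ x y n₀ n₁ n₂ n₃ : ℝ) :
    BFm1 ζ w ψ x y n₀ n₁ n₂ n₃ 3 1 =
      ((ψ * (ζ * w - 1) * nvec n₀ n₁ n₂ n₃ 3 * nvec n₀ n₁ n₂ n₃ 1 : ℝ) : ℂ) • (1 : Matrix (Fin 3) (Fin 3) ℂ) +
        I • (BFdeg1 ζ w ψ x y n₀ n₁ n₂ n₃ 3 1).map ((↑) : ℝ → ℂ) + (BFdeg2 ζ w ψ x y n₀ n₁ n₂ n₃ 3 1).map ((↑) : ℝ → ℂ) := by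
  ext i j
  fin_cases i <;> fin_cases j <;> simp [BFm1, PsqUnit, KFPUnit, Pmat, nvec, BFdeg1, BFdeg2] <;> ring

/-- Block `(3,2)` of `BF − 1` ((VI.9), first line, unit sphere) = `ψ(ζw − 1)n_3n_2·1 + i·R¹_{32} + R²_{32}`. [cite: MagnenRivasseauSeneor1993, §VI (VI.9) p.370] -/
theorem BFm1_decomp_32 (ζ w ψ x y n₀ n₁ n₂ n₃ : ℝ) :
    BFm1 ζ w ψ x y n₀ n₁ n₂ n₃ 3 2 =
      ((ψ * (ζ * w - 1) * nvec n₀ n₁ n₂ n₃ 3 * nvec n₀ n₁ n₂ n₃ 2 : ℝ) : ℂ) • (1 : Matrix (Fin 3) (Fin 3) ℂ) +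
        I • (BFdeg1 ζ w ψ x y n₀ n₁ n₂ n₃ 3 2).map ((↑) : ℝ → ℂ) + (BFdeg2 ζ w ψ x y n₀ n₁ n₂ n₃ 3 2).map ((↑) : ℝ → ℂ) := by
  ext i j
  fin_cases i <;> fin_cases j <;> simp [BFm1, PsqUnit, KFPUnit, Pmat, nvec, BFdeg1, BFdeg2] <;> ring

/-- Block `(3,3)` of `BF − 1` ((VI.9), first line, unit sphere) = `ψ(ζw − 1)n_3n_3·1 + i·R¹_{33} + R²_{33}`. [cite: MagnenRivasseauSeneor1993, §VI (VI.9) p.370] -/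
theorem BFm1_decomp_33 (ζ w ψ x y n₀ n₁ n₂ n₃ : ℝ) :
    BFm1 ζ w ψ x y n₀ n₁ n₂ n₃ 3 3 =
      ((ψ * (ζ * w - 1) * nvec n₀ n₁ n₂ n₃ 3 * nvec n₀ n₁ n₂ n₃ 3 : ℝ) : ℂ) • (1 : Matrix (Fin 3) (Fin 3) ℂ) +
        I • (BFdeg1 ζ w ψ x y n₀ n₁ n₂ n₃ 3 3).map ((↑) : ℝ → ℂ) + (BFdeg2 ζ w ψ x y n₀ n₁ n₂ n₃ 3 3).map ((↑) : ℝ → ℂ) := by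
  ext i j
  fin_cases i <;> fin_cases j <;> simp [BFm1, PsqUnit, KFPUnit, Pmat, nvec, BFdeg1, BFdeg2] <;> ring

/-- **The operator of (VI.9), first line, is not `μ ↔ ν` symmetric** (so the printed «W₀₁ = W₁₀», «W₀₂ = W₂₀», «W₁₃ = W₃₁»,
«W₂₃ = W₃₂» of (VI.12b–e) cannot all be its blocks): the degree-one parts of the blocks `(1,0)` and `(0,1)` differ in the entry `(2,3)` by
`ψ x n₀ (ζ − 1)(1 − w)` — nonzero for `ζ ≠ 1`, `w = ζ⁻¹`, `n₀x ≠ 0`. [cite: MagnenRivasseauSeneor1993, §VI (VI.9), (VI.12b) p.370] -/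
theorem BFdeg1_not_symmetric (ζ w ψ x y n₀ n₁ n₂ n₃ : ℝ) :
    (BFdeg1 ζ w ψ x y n₀ n₁ n₂ n₃ 1 0 - BFdeg1 ζ w ψ x y n₀ n₁ n₂ n₃ 0 1) 1 2 = ψ * x * n₀ * (ζ - 1) * (1 - w) := by
  simp [BFdeg1]
  ring

/-- **(VI.12g), one sign, AS PRINTED vs the operator.** With `W₁₂ := (BF − 1)₁₂/ψ − n₁n₂V` and `V₂₁ = 0` ((VI.11)), the entry `(2,1)` of
`W₁₂` is the entry `(2,1)` of `R²₁₂/ψ`; for the operator it is `xy(1 − ζ)[1 + (w − 1)n₂²]` (`= xy[(1 − ζ) + ((1 − ζ)²/ζ)n₂²]` at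
`w = ζ⁻¹`), whereas (VI.12g) prints «((1−ζ)²/ζ · p₂²/p² − (1 − ζ))xy» (the sign of `(1 − ζ)`; the analogous entries of the printed W₁₁,
W₂₁, W₂₂ carry `+ (1 − ζ)` and agree with the operator). Recorded, not repaired. [cite: MagnenRivasseauSeneor1993, §VI (VI.12g) p.371] -/
theorem BFdeg2_12_entry21 (ζ w ψ x y n₀ n₁ n₂ n₃ : ℝ) :
    (BFdeg2 ζ w ψ x y n₀ n₁ n₂ n₃ 1 2) 1 0 = ψ * (x * y) * ((1 - ζ) * (1 + (w - 1) * (n₂ * n₂))) := by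
  simp [BFdeg2]
  ring

/-- **The first order in `β` of `ln det BF`, by traces** («It can be done by tracing the twelve by twelve matrix (VI.9) and its square,
which is much easier than computing the determinant», p.373 tl.17–18). With `M := BF − 1 = M⁰ + iR¹ + R²` blockwise (`BFm1_decomp_μν`;
`M⁰ = 0` for `w = ζ⁻¹`; `R¹` of order `√β`, `R²` of order `β`), the first order of `tr M − ½tr M²` is
`tr R² − ½tr((iR¹)²) = Σ_μ tr R²_μμ + ½Σ_μ Σ_ν tr(R¹_μν R¹_νμ)`. [cite: MagnenRivasseauSeneor1993, §VI (VI.17) p.373] -/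
noncomputable def lnDetFirstOrder (ζ w ψ x y n₀ n₁ n₂ n₃ : ℝ) : ℝ :=
  (∑ μ : Fin 4, Matrix.trace (BFdeg2 ζ w ψ x y n₀ n₁ n₂ n₃ μ μ)) +
    (1 / 2) * ∑ μ : Fin 4, ∑ ν : Fin 4, Matrix.trace (BFdeg1 ζ w ψ x y n₀ n₁ n₂ n₃ μ ν * BFdeg1 ζ w ψ x y n₀ n₁ n₂ n₃ ν μ)

/-- `tr R²_{00}` (a polynomial; generated, kernel-checked). [cite: MagnenRivasseauSeneor1993, §VI (VI.9), (VI.17) pp.370, 373] -/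
theorem trDeg2_0 (ζ w ψ x y n₀ n₁ n₂ n₃ : ℝ) :
    Matrix.trace (BFdeg2 ζ w ψ x y n₀ n₁ n₂ n₃ 0 0) =
      2 * y * y * ψ - 2 * y * y * n₀ * n₀ * ψ + 2 * y * y * n₀ * n₀ * ψ * w + 2 * x * x * ψ - 2 * x * x * n₀ * n₀ * ψ
        + 2 * x * x * n₀ * n₀ * ψ * w := by
  rw [Matrix.trace_fin_three]
  simp [BFdeg2]
  ring

/-- `tr R²_{11}` (a polynomial; generated, kernel-checked). [cite: MagnenRivasseauSeneor1993, §VI (VI.9), (VI.17) pp.370, 373] -/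
theorem trDeg2_1 (ζ w ψ x y n₀ n₁ n₂ n₃ : ℝ) :
    Matrix.trace (BFdeg2 ζ w ψ x y n₀ n₁ n₂ n₃ 1 1) =
      2 * y * y * ψ - 2 * y * y * n₁ * n₁ * ψ + 2 * y * y * n₁ * n₁ * ψ * w + 2 * x * x * ψ * ζ - 2 * x * x * n₁ * n₁
        * ψ * ζ + 2 * x * x * n₁ * n₁ * ψ * ζ * w := by
  rw [Matrix.trace_fin_three]
  simp [BFdeg2]
  ring

/-- `tr R²_{22}` (a polynomial; generated, kernel-checked). [cite: MagnenRivasseauSeneor1993, §VI (VI.9), (VI.17) pp.370, 373] -/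
theorem trDeg2_2 (ζ w ψ x y n₀ n₁ n₂ n₃ : ℝ) :
    Matrix.trace (BFdeg2 ζ w ψ x y n₀ n₁ n₂ n₃ 2 2) =
      2 * y * y * ψ * ζ - 2 * y * y * n₂ * n₂ * ψ * ζ + 2 * y * y * n₂ * n₂ * ψ * ζ * w + 2 * x * x * ψ - 2 * x * x *
        n₂ * n₂ * ψ + 2 * x * x * n₂ * n₂ * ψ * w := by
  rw [Matrix.trace_fin_three]
  simp [BFdeg2]
  ring

/-- `tr R²_{33}` (a polynomial; generated, kernel-checked). [cite: MagnenRivasseauSeneor1993, §VI (VI.9), (VI.17) pp.370, 373] -/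
theorem trDeg2_3 (ζ w ψ x y n₀ n₁ n₂ n₃ : ℝ) :
    Matrix.trace (BFdeg2 ζ w ψ x y n₀ n₁ n₂ n₃ 3 3) =
      2 * y * y * ψ - 2 * y * y * n₃ * n₃ * ψ + 2 * y * y * n₃ * n₃ * ψ * w + 2 * x * x * ψ - 2 * x * x * n₃ * n₃ * ψ
        + 2 * x * x * n₃ * n₃ * ψ * w := by
  rw [Matrix.trace_fin_three]
  simp [BFdeg2]
  ring

/-- `tr(R¹_{00} R¹_{00})` (a polynomial; generated, kernel-checked). [cite: MagnenRivasseauSeneor1993, §VI (VI.9), (VI.17) pp.370, 373] -/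
theorem trDeg1Sq_00 (ζ w ψ x y n₀ n₁ n₂ n₃ : ℝ) :
    Matrix.trace (BFdeg1 ζ w ψ x y n₀ n₁ n₂ n₃ 0 0 * BFdeg1 ζ w ψ x y n₀ n₁ n₂ n₃ 0 0) =
      -8 * y * y * n₂ * n₂ * ψ * ψ + 8 * y * y * n₀ * n₀ * n₂ * n₂ * ψ * ψ - 8 * y * y * n₀ * n₀ * n₂ * n₂ * ψ * ψ * w
        + 8 * y * y * n₀ * n₀ * n₂ * n₂ * ψ * ψ * ζ - 8 * y * y * n₀ * n₀ * n₂ * n₂ * ψ * ψ * ζ * w - 2 * y * y * n₀ *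
        n₀ * n₀ * n₀ * n₂ * n₂ * ψ * ψ + 4 * y * y * n₀ * n₀ * n₀ * n₀ * n₂ * n₂ * ψ * ψ * w - 2 * y * y * n₀ * n₀ *
        n₀ * n₀ * n₂ * n₂ * ψ * ψ * w * w - 4 * y * y * n₀ * n₀ * n₀ * n₀ * n₂ * n₂ * ψ * ψ * ζ + 8 * y * y * n₀ * n₀
        * n₀ * n₀ * n₂ * n₂ * ψ * ψ * ζ * w - 4 * y * y * n₀ * n₀ * n₀ * n₀ * n₂ * n₂ * ψ * ψ * ζ * w * w - 2 * y * y
        * n₀ * n₀ * n₀ * n₀ * n₂ * n₂ * ψ * ψ * ζ * ζ + 4 * y * y * n₀ * n₀ * n₀ * n₀ * n₂ * n₂ * ψ * ψ * ζ * ζ * w -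
        2 * y * y * n₀ * n₀ * n₀ * n₀ * n₂ * n₂ * ψ * ψ * ζ * ζ * w * w - 8 * x * x * n₁ * n₁ * ψ * ψ + 8 * x * x * n₀
        * n₀ * n₁ * n₁ * ψ * ψ - 8 * x * x * n₀ * n₀ * n₁ * n₁ * ψ * ψ * w + 8 * x * x * n₀ * n₀ * n₁ * n₁ * ψ * ψ * ζ
        - 8 * x * x * n₀ * n₀ * n₁ * n₁ * ψ * ψ * ζ * w - 2 * x * x * n₀ * n₀ * n₀ * n₀ * n₁ * n₁ * ψ * ψ + 4 * x * x
        * n₀ * n₀ * n₀ * n₀ * n₁ * n₁ * ψ * ψ * w - 2 * x * x * n₀ * n₀ * n₀ * n₀ * n₁ * n₁ * ψ * ψ * w * w - 4 * x *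
        x * n₀ * n₀ * n₀ * n₀ * n₁ * n₁ * ψ * ψ * ζ + 8 * x * x * n₀ * n₀ * n₀ * n₀ * n₁ * n₁ * ψ * ψ * ζ * w - 4 * x
        * x * n₀ * n₀ * n₀ * n₀ * n₁ * n₁ * ψ * ψ * ζ * w * w - 2 * x * x * n₀ * n₀ * n₀ * n₀ * n₁ * n₁ * ψ * ψ * ζ *
        ζ + 4 * x * x * n₀ * n₀ * n₀ * n₀ * n₁ * n₁ * ψ * ψ * ζ * ζ * w - 2 * x * x * n₀ * n₀ * n₀ * n₀ * n₁ * n₁ * ψ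
        * ψ * ζ * ζ * w * w := by
  rw [Matrix.trace_fin_three]
  simp [BFdeg1, Matrix.mul_apply, Fin.sum_univ_three]
  ring

/-- `tr(R¹_{01} R¹_{10})` (a polynomial; generated, kernel-checked). [cite: MagnenRivasseauSeneor1993, §VI (VI.9), (VI.17) pp.370, 373] -/
theorem trDeg1Sq_01 (ζ w ψ x y n₀ n₁ n₂ n₃ : ℝ) :
    Matrix.trace (BFdeg1 ζ w ψ x y n₀ n₁ n₂ n₃ 0 1 * BFdeg1 ζ w ψ x y n₀ n₁ n₂ n₃ 1 0) =
      -2 * y * y * n₀ * n₀ * n₁ * n₁ * n₂ * n₂ * ψ * ψ + 4 * y * y * n₀ * n₀ * n₁ * n₁ * n₂ * n₂ * ψ * ψ * w - 2 * y *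
        y * n₀ * n₀ * n₁ * n₁ * n₂ * n₂ * ψ * ψ * w * w - 4 * y * y * n₀ * n₀ * n₁ * n₁ * n₂ * n₂ * ψ * ψ * ζ + 8 * y
        * y * n₀ * n₀ * n₁ * n₁ * n₂ * n₂ * ψ * ψ * ζ * w - 4 * y * y * n₀ * n₀ * n₁ * n₁ * n₂ * n₂ * ψ * ψ * ζ * w *
        w - 2 * y * y * n₀ * n₀ * n₁ * n₁ * n₂ * n₂ * ψ * ψ * ζ * ζ + 4 * y * y * n₀ * n₀ * n₁ * n₁ * n₂ * n₂ * ψ * ψ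
        * ζ * ζ * w - 2 * y * y * n₀ * n₀ * n₁ * n₁ * n₂ * n₂ * ψ * ψ * ζ * ζ * w * w - 2 * x * x * n₀ * n₀ * ψ * ψ *
        w + 4 * x * x * n₀ * n₀ * ψ * ψ * ζ * w - 2 * x * x * n₀ * n₀ * ψ * ψ * ζ * ζ * w - 2 * x * x * n₀ * n₀ * n₁ *
        n₁ * ψ * ψ + 2 * x * x * n₀ * n₀ * n₁ * n₁ * ψ * ψ * w * w + 2 * x * x * n₀ * n₀ * n₁ * n₁ * ψ * ψ * ζ * ζ - 2
        * x * x * n₀ * n₀ * n₁ * n₁ * ψ * ψ * ζ * ζ * w * w - 2 * x * x * n₀ * n₀ * n₁ * n₁ * n₁ * n₁ * ψ * ψ + 4 * x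
        * x * n₀ * n₀ * n₁ * n₁ * n₁ * n₁ * ψ * ψ * w - 2 * x * x * n₀ * n₀ * n₁ * n₁ * n₁ * n₁ * ψ * ψ * w * w - 4 *
        x * x * n₀ * n₀ * n₁ * n₁ * n₁ * n₁ * ψ * ψ * ζ + 8 * x * x * n₀ * n₀ * n₁ * n₁ * n₁ * n₁ * ψ * ψ * ζ * w - 4
        * x * x * n₀ * n₀ * n₁ * n₁ * n₁ * n₁ * ψ * ψ * ζ * w * w - 2 * x * x * n₀ * n₀ * n₁ * n₁ * n₁ * n₁ * ψ * ψ *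
        ζ * ζ + 4 * x * x * n₀ * n₀ * n₁ * n₁ * n₁ * n₁ * ψ * ψ * ζ * ζ * w - 2 * x * x * n₀ * n₀ * n₁ * n₁ * n₁ * n₁
        * ψ * ψ * ζ * ζ * w * w := by
  rw [Matrix.trace_fin_three]
  simp [BFdeg1, Matrix.mul_apply, Fin.sum_univ_three]
  ring

/-- `tr(R¹_{02} R¹_{20})` (a polynomial; generated, kernel-checked). [cite: MagnenRivasseauSeneor1993, §VI (VI.9), (VI.17) pp.370, 373] -/
theorem trDeg1Sq_02 (ζ w ψ x y n₀ n₁ n₂ n₃ : ℝ) :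
    Matrix.trace (BFdeg1 ζ w ψ x y n₀ n₁ n₂ n₃ 0 2 * BFdeg1 ζ w ψ x y n₀ n₁ n₂ n₃ 2 0) =
      -2 * y * y * n₀ * n₀ * ψ * ψ * w + 4 * y * y * n₀ * n₀ * ψ * ψ * ζ * w - 2 * y * y * n₀ * n₀ * ψ * ψ * ζ * ζ * w
        - 2 * y * y * n₀ * n₀ * n₂ * n₂ * ψ * ψ + 2 * y * y * n₀ * n₀ * n₂ * n₂ * ψ * ψ * w * w + 2 * y * y * n₀ * n₀
        * n₂ * n₂ * ψ * ψ * ζ * ζ - 2 * y * y * n₀ * n₀ * n₂ * n₂ * ψ * ψ * ζ * ζ * w * w - 2 * y * y * n₀ * n₀ * n₂ *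
        n₂ * n₂ * n₂ * ψ * ψ + 4 * y * y * n₀ * n₀ * n₂ * n₂ * n₂ * n₂ * ψ * ψ * w - 2 * y * y * n₀ * n₀ * n₂ * n₂ *
        n₂ * n₂ * ψ * ψ * w * w - 4 * y * y * n₀ * n₀ * n₂ * n₂ * n₂ * n₂ * ψ * ψ * ζ + 8 * y * y * n₀ * n₀ * n₂ * n₂
        * n₂ * n₂ * ψ * ψ * ζ * w - 4 * y * y * n₀ * n₀ * n₂ * n₂ * n₂ * n₂ * ψ * ψ * ζ * w * w - 2 * y * y * n₀ * n₀
        * n₂ * n₂ * n₂ * n₂ * ψ * ψ * ζ * ζ + 4 * y * y * n₀ * n₀ * n₂ * n₂ * n₂ * n₂ * ψ * ψ * ζ * ζ * w - 2 * y * y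
        * n₀ * n₀ * n₂ * n₂ * n₂ * n₂ * ψ * ψ * ζ * ζ * w * w - 2 * x * x * n₀ * n₀ * n₁ * n₁ * n₂ * n₂ * ψ * ψ + 4 *
        x * x * n₀ * n₀ * n₁ * n₁ * n₂ * n₂ * ψ * ψ * w - 2 * x * x * n₀ * n₀ * n₁ * n₁ * n₂ * n₂ * ψ * ψ * w * w - 4
        * x * x * n₀ * n₀ * n₁ * n₁ * n₂ * n₂ * ψ * ψ * ζ + 8 * x * x * n₀ * n₀ * n₁ * n₁ * n₂ * n₂ * ψ * ψ * ζ * w -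
        4 * x * x * n₀ * n₀ * n₁ * n₁ * n₂ * n₂ * ψ * ψ * ζ * w * w - 2 * x * x * n₀ * n₀ * n₁ * n₁ * n₂ * n₂ * ψ * ψ
        * ζ * ζ + 4 * x * x * n₀ * n₀ * n₁ * n₁ * n₂ * n₂ * ψ * ψ * ζ * ζ * w - 2 * x * x * n₀ * n₀ * n₁ * n₁ * n₂ *
        n₂ * ψ * ψ * ζ * ζ * w * w := by
  rw [Matrix.trace_fin_three]
  simp [BFdeg1, Matrix.mul_apply, Fin.sum_univ_three]
  ring

/-- `tr(R¹_{03} R¹_{30})` (a polynomial; generated, kernel-checked). [cite: MagnenRivasseauSeneor1993, §VI (VI.9), (VI.17) pp.370, 373] -/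
theorem trDeg1Sq_03 (ζ w ψ x y n₀ n₁ n₂ n₃ : ℝ) :
    Matrix.trace (BFdeg1 ζ w ψ x y n₀ n₁ n₂ n₃ 0 3 * BFdeg1 ζ w ψ x y n₀ n₁ n₂ n₃ 3 0) =
      -2 * y * y * n₀ * n₀ * n₂ * n₂ * n₃ * n₃ * ψ * ψ + 4 * y * y * n₀ * n₀ * n₂ * n₂ * n₃ * n₃ * ψ * ψ * w - 2 * y *
        y * n₀ * n₀ * n₂ * n₂ * n₃ * n₃ * ψ * ψ * w * w - 4 * y * y * n₀ * n₀ * n₂ * n₂ * n₃ * n₃ * ψ * ψ * ζ + 8 * y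
        * y * n₀ * n₀ * n₂ * n₂ * n₃ * n₃ * ψ * ψ * ζ * w - 4 * y * y * n₀ * n₀ * n₂ * n₂ * n₃ * n₃ * ψ * ψ * ζ * w *
        w - 2 * y * y * n₀ * n₀ * n₂ * n₂ * n₃ * n₃ * ψ * ψ * ζ * ζ + 4 * y * y * n₀ * n₀ * n₂ * n₂ * n₃ * n₃ * ψ * ψ
        * ζ * ζ * w - 2 * y * y * n₀ * n₀ * n₂ * n₂ * n₃ * n₃ * ψ * ψ * ζ * ζ * w * w - 2 * x * x * n₀ * n₀ * n₁ * n₁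
        * n₃ * n₃ * ψ * ψ + 4 * x * x * n₀ * n₀ * n₁ * n₁ * n₃ * n₃ * ψ * ψ * w - 2 * x * x * n₀ * n₀ * n₁ * n₁ * n₃ *
        n₃ * ψ * ψ * w * w - 4 * x * x * n₀ * n₀ * n₁ * n₁ * n₃ * n₃ * ψ * ψ * ζ + 8 * x * x * n₀ * n₀ * n₁ * n₁ * n₃
        * n₃ * ψ * ψ * ζ * w - 4 * x * x * n₀ * n₀ * n₁ * n₁ * n₃ * n₃ * ψ * ψ * ζ * w * w - 2 * x * x * n₀ * n₀ * n₁
        * n₁ * n₃ * n₃ * ψ * ψ * ζ * ζ + 4 * x * x * n₀ * n₀ * n₁ * n₁ * n₃ * n₃ * ψ * ψ * ζ * ζ * w - 2 * x * x * n₀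
        * n₀ * n₁ * n₁ * n₃ * n₃ * ψ * ψ * ζ * ζ * w * w := by
  rw [Matrix.trace_fin_three]
  simp [BFdeg1, Matrix.mul_apply, Fin.sum_univ_three]
  ring

/-- `tr(R¹_{10} R¹_{01})` (a polynomial; generated, kernel-checked). [cite: MagnenRivasseauSeneor1993, §VI (VI.9), (VI.17) pp.370, 373] -/
theorem trDeg1Sq_10 (ζ w ψ x y n₀ n₁ n₂ n₃ : ℝ) :
    Matrix.trace (BFdeg1 ζ w ψ x y n₀ n₁ n₂ n₃ 1 0 * BFdeg1 ζ w ψ x y n₀ n₁ n₂ n₃ 0 1) =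
      -2 * y * y * n₀ * n₀ * n₁ * n₁ * n₂ * n₂ * ψ * ψ + 4 * y * y * n₀ * n₀ * n₁ * n₁ * n₂ * n₂ * ψ * ψ * w - 2 * y *
        y * n₀ * n₀ * n₁ * n₁ * n₂ * n₂ * ψ * ψ * w * w - 4 * y * y * n₀ * n₀ * n₁ * n₁ * n₂ * n₂ * ψ * ψ * ζ + 8 * y
        * y * n₀ * n₀ * n₁ * n₁ * n₂ * n₂ * ψ * ψ * ζ * w - 4 * y * y * n₀ * n₀ * n₁ * n₁ * n₂ * n₂ * ψ * ψ * ζ * w *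
        w - 2 * y * y * n₀ * n₀ * n₁ * n₁ * n₂ * n₂ * ψ * ψ * ζ * ζ + 4 * y * y * n₀ * n₀ * n₁ * n₁ * n₂ * n₂ * ψ * ψ
        * ζ * ζ * w - 2 * y * y * n₀ * n₀ * n₁ * n₁ * n₂ * n₂ * ψ * ψ * ζ * ζ * w * w - 2 * x * x * n₀ * n₀ * ψ * ψ *
        w + 4 * x * x * n₀ * n₀ * ψ * ψ * ζ * w - 2 * x * x * n₀ * n₀ * ψ * ψ * ζ * ζ * w - 2 * x * x * n₀ * n₀ * n₁ *
        n₁ * ψ * ψ + 2 * x * x * n₀ * n₀ * n₁ * n₁ * ψ * ψ * w * w + 2 * x * x * n₀ * n₀ * n₁ * n₁ * ψ * ψ * ζ * ζ - 2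
        * x * x * n₀ * n₀ * n₁ * n₁ * ψ * ψ * ζ * ζ * w * w - 2 * x * x * n₀ * n₀ * n₁ * n₁ * n₁ * n₁ * ψ * ψ + 4 * x
        * x * n₀ * n₀ * n₁ * n₁ * n₁ * n₁ * ψ * ψ * w - 2 * x * x * n₀ * n₀ * n₁ * n₁ * n₁ * n₁ * ψ * ψ * w * w - 4 *
        x * x * n₀ * n₀ * n₁ * n₁ * n₁ * n₁ * ψ * ψ * ζ + 8 * x * x * n₀ * n₀ * n₁ * n₁ * n₁ * n₁ * ψ * ψ * ζ * w - 4
        * x * x * n₀ * n₀ * n₁ * n₁ * n₁ * n₁ * ψ * ψ * ζ * w * w - 2 * x * x * n₀ * n₀ * n₁ * n₁ * n₁ * n₁ * ψ * ψ *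
        ζ * ζ + 4 * x * x * n₀ * n₀ * n₁ * n₁ * n₁ * n₁ * ψ * ψ * ζ * ζ * w - 2 * x * x * n₀ * n₀ * n₁ * n₁ * n₁ * n₁
        * ψ * ψ * ζ * ζ * w * w := by
  rw [Matrix.trace_fin_three]
  simp [BFdeg1, Matrix.mul_apply, Fin.sum_univ_three]
  ring

/-- `tr(R¹_{11} R¹_{11})` (a polynomial; generated, kernel-checked). [cite: MagnenRivasseauSeneor1993, §VI (VI.9), (VI.17) pp.370, 373] -/
theorem trDeg1Sq_11 (ζ w ψ x y n₀ n₁ n₂ n₃ : ℝ) :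
    Matrix.trace (BFdeg1 ζ w ψ x y n₀ n₁ n₂ n₃ 1 1 * BFdeg1 ζ w ψ x y n₀ n₁ n₂ n₃ 1 1) =
      -8 * y * y * n₂ * n₂ * ψ * ψ + 8 * y * y * n₁ * n₁ * n₂ * n₂ * ψ * ψ - 8 * y * y * n₁ * n₁ * n₂ * n₂ * ψ * ψ * w
        + 8 * y * y * n₁ * n₁ * n₂ * n₂ * ψ * ψ * ζ - 8 * y * y * n₁ * n₁ * n₂ * n₂ * ψ * ψ * ζ * w - 2 * y * y * n₁ *
        n₁ * n₁ * n₁ * n₂ * n₂ * ψ * ψ + 4 * y * y * n₁ * n₁ * n₁ * n₁ * n₂ * n₂ * ψ * ψ * w - 2 * y * y * n₁ * n₁ *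
        n₁ * n₁ * n₂ * n₂ * ψ * ψ * w * w - 4 * y * y * n₁ * n₁ * n₁ * n₁ * n₂ * n₂ * ψ * ψ * ζ + 8 * y * y * n₁ * n₁
        * n₁ * n₁ * n₂ * n₂ * ψ * ψ * ζ * w - 4 * y * y * n₁ * n₁ * n₁ * n₁ * n₂ * n₂ * ψ * ψ * ζ * w * w - 2 * y * y
        * n₁ * n₁ * n₁ * n₁ * n₂ * n₂ * ψ * ψ * ζ * ζ + 4 * y * y * n₁ * n₁ * n₁ * n₁ * n₂ * n₂ * ψ * ψ * ζ * ζ * w -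
        2 * y * y * n₁ * n₁ * n₁ * n₁ * n₂ * n₂ * ψ * ψ * ζ * ζ * w * w - 2 * x * x * n₁ * n₁ * ψ * ψ + 4 * x * x * n₁
        * n₁ * ψ * ψ * w - 2 * x * x * n₁ * n₁ * ψ * ψ * w * w - 4 * x * x * n₁ * n₁ * ψ * ψ * ζ + 4 * x * x * n₁ * n₁
        * ψ * ψ * ζ * w * w - 2 * x * x * n₁ * n₁ * ψ * ψ * ζ * ζ - 4 * x * x * n₁ * n₁ * ψ * ψ * ζ * ζ * w - 2 * x *
        x * n₁ * n₁ * ψ * ψ * ζ * ζ * w * w + 4 * x * x * n₁ * n₁ * n₁ * n₁ * ψ * ψ - 8 * x * x * n₁ * n₁ * n₁ * n₁ *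
        ψ * ψ * w + 4 * x * x * n₁ * n₁ * n₁ * n₁ * ψ * ψ * w * w + 8 * x * x * n₁ * n₁ * n₁ * n₁ * ψ * ψ * ζ - 8 * x
        * x * n₁ * n₁ * n₁ * n₁ * ψ * ψ * ζ * w + 4 * x * x * n₁ * n₁ * n₁ * n₁ * ψ * ψ * ζ * ζ - 4 * x * x * n₁ * n₁
        * n₁ * n₁ * ψ * ψ * ζ * ζ * w * w - 2 * x * x * n₁ * n₁ * n₁ * n₁ * n₁ * n₁ * ψ * ψ + 4 * x * x * n₁ * n₁ * n₁
        * n₁ * n₁ * n₁ * ψ * ψ * w - 2 * x * x * n₁ * n₁ * n₁ * n₁ * n₁ * n₁ * ψ * ψ * w * w - 4 * x * x * n₁ * n₁ *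
        n₁ * n₁ * n₁ * n₁ * ψ * ψ * ζ + 8 * x * x * n₁ * n₁ * n₁ * n₁ * n₁ * n₁ * ψ * ψ * ζ * w - 4 * x * x * n₁ * n₁
        * n₁ * n₁ * n₁ * n₁ * ψ * ψ * ζ * w * w - 2 * x * x * n₁ * n₁ * n₁ * n₁ * n₁ * n₁ * ψ * ψ * ζ * ζ + 4 * x * x
        * n₁ * n₁ * n₁ * n₁ * n₁ * n₁ * ψ * ψ * ζ * ζ * w - 2 * x * x * n₁ * n₁ * n₁ * n₁ * n₁ * n₁ * ψ * ψ * ζ * ζ *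
        w * w := by
  rw [Matrix.trace_fin_three]
  simp [BFdeg1, Matrix.mul_apply, Fin.sum_univ_three]
  ring

/-- `tr(R¹_{12} R¹_{21})` (a polynomial; generated, kernel-checked). [cite: MagnenRivasseauSeneor1993, §VI (VI.9), (VI.17) pp.370, 373] -/
theorem trDeg1Sq_12 (ζ w ψ x y n₀ n₁ n₂ n₃ : ℝ) :
    Matrix.trace (BFdeg1 ζ w ψ x y n₀ n₁ n₂ n₃ 1 2 * BFdeg1 ζ w ψ x y n₀ n₁ n₂ n₃ 2 1) =
      -2 * y * y * n₁ * n₁ * ψ * ψ * w + 4 * y * y * n₁ * n₁ * ψ * ψ * ζ * w - 2 * y * y * n₁ * n₁ * ψ * ψ * ζ * ζ * w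
        - 2 * y * y * n₁ * n₁ * n₂ * n₂ * ψ * ψ + 2 * y * y * n₁ * n₁ * n₂ * n₂ * ψ * ψ * w * w + 2 * y * y * n₁ * n₁
        * n₂ * n₂ * ψ * ψ * ζ * ζ - 2 * y * y * n₁ * n₁ * n₂ * n₂ * ψ * ψ * ζ * ζ * w * w - 2 * y * y * n₁ * n₁ * n₂ *
        n₂ * n₂ * n₂ * ψ * ψ + 4 * y * y * n₁ * n₁ * n₂ * n₂ * n₂ * n₂ * ψ * ψ * w - 2 * y * y * n₁ * n₁ * n₂ * n₂ *
        n₂ * n₂ * ψ * ψ * w * w - 4 * y * y * n₁ * n₁ * n₂ * n₂ * n₂ * n₂ * ψ * ψ * ζ + 8 * y * y * n₁ * n₁ * n₂ * n₂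
        * n₂ * n₂ * ψ * ψ * ζ * w - 4 * y * y * n₁ * n₁ * n₂ * n₂ * n₂ * n₂ * ψ * ψ * ζ * w * w - 2 * y * y * n₁ * n₁
        * n₂ * n₂ * n₂ * n₂ * ψ * ψ * ζ * ζ + 4 * y * y * n₁ * n₁ * n₂ * n₂ * n₂ * n₂ * ψ * ψ * ζ * ζ * w - 2 * y * y
        * n₁ * n₁ * n₂ * n₂ * n₂ * n₂ * ψ * ψ * ζ * ζ * w * w - 2 * x * x * n₂ * n₂ * ψ * ψ * w + 4 * x * x * n₂ * n₂
        * ψ * ψ * ζ * w - 2 * x * x * n₂ * n₂ * ψ * ψ * ζ * ζ * w - 2 * x * x * n₁ * n₁ * n₂ * n₂ * ψ * ψ + 2 * x * x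
        * n₁ * n₁ * n₂ * n₂ * ψ * ψ * w * w + 2 * x * x * n₁ * n₁ * n₂ * n₂ * ψ * ψ * ζ * ζ - 2 * x * x * n₁ * n₁ * n₂
        * n₂ * ψ * ψ * ζ * ζ * w * w - 2 * x * x * n₁ * n₁ * n₁ * n₁ * n₂ * n₂ * ψ * ψ + 4 * x * x * n₁ * n₁ * n₁ * n₁
        * n₂ * n₂ * ψ * ψ * w - 2 * x * x * n₁ * n₁ * n₁ * n₁ * n₂ * n₂ * ψ * ψ * w * w - 4 * x * x * n₁ * n₁ * n₁ *
        n₁ * n₂ * n₂ * ψ * ψ * ζ + 8 * x * x * n₁ * n₁ * n₁ * n₁ * n₂ * n₂ * ψ * ψ * ζ * w - 4 * x * x * n₁ * n₁ * n₁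
        * n₁ * n₂ * n₂ * ψ * ψ * ζ * w * w - 2 * x * x * n₁ * n₁ * n₁ * n₁ * n₂ * n₂ * ψ * ψ * ζ * ζ + 4 * x * x * n₁
        * n₁ * n₁ * n₁ * n₂ * n₂ * ψ * ψ * ζ * ζ * w - 2 * x * x * n₁ * n₁ * n₁ * n₁ * n₂ * n₂ * ψ * ψ * ζ * ζ * w * w := by
  rw [Matrix.trace_fin_three]
  simp [BFdeg1, Matrix.mul_apply, Fin.sum_univ_three]
  ring

/-- `tr(R¹_{13} R¹_{31})` (a polynomial; generated, kernel-checked). [cite: MagnenRivasseauSeneor1993, §VI (VI.9), (VI.17) pp.370, 373] -/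
theorem trDeg1Sq_13 (ζ w ψ x y n₀ n₁ n₂ n₃ : ℝ) :
    Matrix.trace (BFdeg1 ζ w ψ x y n₀ n₁ n₂ n₃ 1 3 * BFdeg1 ζ w ψ x y n₀ n₁ n₂ n₃ 3 1) =
      -2 * y * y * n₁ * n₁ * n₂ * n₂ * n₃ * n₃ * ψ * ψ + 4 * y * y * n₁ * n₁ * n₂ * n₂ * n₃ * n₃ * ψ * ψ * w - 2 * y *
        y * n₁ * n₁ * n₂ * n₂ * n₃ * n₃ * ψ * ψ * w * w - 4 * y * y * n₁ * n₁ * n₂ * n₂ * n₃ * n₃ * ψ * ψ * ζ + 8 * y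
        * y * n₁ * n₁ * n₂ * n₂ * n₃ * n₃ * ψ * ψ * ζ * w - 4 * y * y * n₁ * n₁ * n₂ * n₂ * n₃ * n₃ * ψ * ψ * ζ * w *
        w - 2 * y * y * n₁ * n₁ * n₂ * n₂ * n₃ * n₃ * ψ * ψ * ζ * ζ + 4 * y * y * n₁ * n₁ * n₂ * n₂ * n₃ * n₃ * ψ * ψ
        * ζ * ζ * w - 2 * y * y * n₁ * n₁ * n₂ * n₂ * n₃ * n₃ * ψ * ψ * ζ * ζ * w * w - 2 * x * x * n₃ * n₃ * ψ * ψ *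
        w + 4 * x * x * n₃ * n₃ * ψ * ψ * ζ * w - 2 * x * x * n₃ * n₃ * ψ * ψ * ζ * ζ * w - 2 * x * x * n₁ * n₁ * n₃ *
        n₃ * ψ * ψ + 2 * x * x * n₁ * n₁ * n₃ * n₃ * ψ * ψ * w * w + 2 * x * x * n₁ * n₁ * n₃ * n₃ * ψ * ψ * ζ * ζ - 2
        * x * x * n₁ * n₁ * n₃ * n₃ * ψ * ψ * ζ * ζ * w * w - 2 * x * x * n₁ * n₁ * n₁ * n₁ * n₃ * n₃ * ψ * ψ + 4 * x
        * x * n₁ * n₁ * n₁ * n₁ * n₃ * n₃ * ψ * ψ * w - 2 * x * x * n₁ * n₁ * n₁ * n₁ * n₃ * n₃ * ψ * ψ * w * w - 4 *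
        x * x * n₁ * n₁ * n₁ * n₁ * n₃ * n₃ * ψ * ψ * ζ + 8 * x * x * n₁ * n₁ * n₁ * n₁ * n₃ * n₃ * ψ * ψ * ζ * w - 4
        * x * x * n₁ * n₁ * n₁ * n₁ * n₃ * n₃ * ψ * ψ * ζ * w * w - 2 * x * x * n₁ * n₁ * n₁ * n₁ * n₃ * n₃ * ψ * ψ *
        ζ * ζ + 4 * x * x * n₁ * n₁ * n₁ * n₁ * n₃ * n₃ * ψ * ψ * ζ * ζ * w - 2 * x * x * n₁ * n₁ * n₁ * n₁ * n₃ * n₃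
        * ψ * ψ * ζ * ζ * w * w := by
  rw [Matrix.trace_fin_three]
  simp [BFdeg1, Matrix.mul_apply, Fin.sum_univ_three]
  ring

/-- `tr(R¹_{20} R¹_{02})` (a polynomial; generated, kernel-checked). [cite: MagnenRivasseauSeneor1993, §VI (VI.9), (VI.17) pp.370, 373] -/
theorem trDeg1Sq_20 (ζ w ψ x y n₀ n₁ n₂ n₃ : ℝ) :
    Matrix.trace (BFdeg1 ζ w ψ x y n₀ n₁ n₂ n₃ 2 0 * BFdeg1 ζ w ψ x y n₀ n₁ n₂ n₃ 0 2) =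
      -2 * y * y * n₀ * n₀ * ψ * ψ * w + 4 * y * y * n₀ * n₀ * ψ * ψ * ζ * w - 2 * y * y * n₀ * n₀ * ψ * ψ * ζ * ζ * w
        - 2 * y * y * n₀ * n₀ * n₂ * n₂ * ψ * ψ + 2 * y * y * n₀ * n₀ * n₂ * n₂ * ψ * ψ * w * w + 2 * y * y * n₀ * n₀
        * n₂ * n₂ * ψ * ψ * ζ * ζ - 2 * y * y * n₀ * n₀ * n₂ * n₂ * ψ * ψ * ζ * ζ * w * w - 2 * y * y * n₀ * n₀ * n₂ *
        n₂ * n₂ * n₂ * ψ * ψ + 4 * y * y * n₀ * n₀ * n₂ * n₂ * n₂ * n₂ * ψ * ψ * w - 2 * y * y * n₀ * n₀ * n₂ * n₂ *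
        n₂ * n₂ * ψ * ψ * w * w - 4 * y * y * n₀ * n₀ * n₂ * n₂ * n₂ * n₂ * ψ * ψ * ζ + 8 * y * y * n₀ * n₀ * n₂ * n₂
        * n₂ * n₂ * ψ * ψ * ζ * w - 4 * y * y * n₀ * n₀ * n₂ * n₂ * n₂ * n₂ * ψ * ψ * ζ * w * w - 2 * y * y * n₀ * n₀
        * n₂ * n₂ * n₂ * n₂ * ψ * ψ * ζ * ζ + 4 * y * y * n₀ * n₀ * n₂ * n₂ * n₂ * n₂ * ψ * ψ * ζ * ζ * w - 2 * y * y
        * n₀ * n₀ * n₂ * n₂ * n₂ * n₂ * ψ * ψ * ζ * ζ * w * w - 2 * x * x * n₀ * n₀ * n₁ * n₁ * n₂ * n₂ * ψ * ψ + 4 *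
        x * x * n₀ * n₀ * n₁ * n₁ * n₂ * n₂ * ψ * ψ * w - 2 * x * x * n₀ * n₀ * n₁ * n₁ * n₂ * n₂ * ψ * ψ * w * w - 4
        * x * x * n₀ * n₀ * n₁ * n₁ * n₂ * n₂ * ψ * ψ * ζ + 8 * x * x * n₀ * n₀ * n₁ * n₁ * n₂ * n₂ * ψ * ψ * ζ * w -
        4 * x * x * n₀ * n₀ * n₁ * n₁ * n₂ * n₂ * ψ * ψ * ζ * w * w - 2 * x * x * n₀ * n₀ * n₁ * n₁ * n₂ * n₂ * ψ * ψ
        * ζ * ζ + 4 * x * x * n₀ * n₀ * n₁ * n₁ * n₂ * n₂ * ψ * ψ * ζ * ζ * w - 2 * x * x * n₀ * n₀ * n₁ * n₁ * n₂ *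
        n₂ * ψ * ψ * ζ * ζ * w * w := by
  rw [Matrix.trace_fin_three]
  simp [BFdeg1, Matrix.mul_apply, Fin.sum_univ_three]
  ring

/-- `tr(R¹_{21} R¹_{12})` (a polynomial; generated, kernel-checked). [cite: MagnenRivasseauSeneor1993, §VI (VI.9), (VI.17) pp.370, 373] -/
theorem trDeg1Sq_21 (ζ w ψ x y n₀ n₁ n₂ n₃ : ℝ) :
    Matrix.trace (BFdeg1 ζ w ψ x y n₀ n₁ n₂ n₃ 2 1 * BFdeg1 ζ w ψ x y n₀ n₁ n₂ n₃ 1 2) =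
      -2 * y * y * n₁ * n₁ * ψ * ψ * w + 4 * y * y * n₁ * n₁ * ψ * ψ * ζ * w - 2 * y * y * n₁ * n₁ * ψ * ψ * ζ * ζ * w
        - 2 * y * y * n₁ * n₁ * n₂ * n₂ * ψ * ψ + 2 * y * y * n₁ * n₁ * n₂ * n₂ * ψ * ψ * w * w + 2 * y * y * n₁ * n₁
        * n₂ * n₂ * ψ * ψ * ζ * ζ - 2 * y * y * n₁ * n₁ * n₂ * n₂ * ψ * ψ * ζ * ζ * w * w - 2 * y * y * n₁ * n₁ * n₂ *
        n₂ * n₂ * n₂ * ψ * ψ + 4 * y * y * n₁ * n₁ * n₂ * n₂ * n₂ * n₂ * ψ * ψ * w - 2 * y * y * n₁ * n₁ * n₂ * n₂ *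
        n₂ * n₂ * ψ * ψ * w * w - 4 * y * y * n₁ * n₁ * n₂ * n₂ * n₂ * n₂ * ψ * ψ * ζ + 8 * y * y * n₁ * n₁ * n₂ * n₂
        * n₂ * n₂ * ψ * ψ * ζ * w - 4 * y * y * n₁ * n₁ * n₂ * n₂ * n₂ * n₂ * ψ * ψ * ζ * w * w - 2 * y * y * n₁ * n₁
        * n₂ * n₂ * n₂ * n₂ * ψ * ψ * ζ * ζ + 4 * y * y * n₁ * n₁ * n₂ * n₂ * n₂ * n₂ * ψ * ψ * ζ * ζ * w - 2 * y * y
        * n₁ * n₁ * n₂ * n₂ * n₂ * n₂ * ψ * ψ * ζ * ζ * w * w - 2 * x * x * n₂ * n₂ * ψ * ψ * w + 4 * x * x * n₂ * n₂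
        * ψ * ψ * ζ * w - 2 * x * x * n₂ * n₂ * ψ * ψ * ζ * ζ * w - 2 * x * x * n₁ * n₁ * n₂ * n₂ * ψ * ψ + 2 * x * x
        * n₁ * n₁ * n₂ * n₂ * ψ * ψ * w * w + 2 * x * x * n₁ * n₁ * n₂ * n₂ * ψ * ψ * ζ * ζ - 2 * x * x * n₁ * n₁ * n₂
        * n₂ * ψ * ψ * ζ * ζ * w * w - 2 * x * x * n₁ * n₁ * n₁ * n₁ * n₂ * n₂ * ψ * ψ + 4 * x * x * n₁ * n₁ * n₁ * n₁
        * n₂ * n₂ * ψ * ψ * w - 2 * x * x * n₁ * n₁ * n₁ * n₁ * n₂ * n₂ * ψ * ψ * w * w - 4 * x * x * n₁ * n₁ * n₁ *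
        n₁ * n₂ * n₂ * ψ * ψ * ζ + 8 * x * x * n₁ * n₁ * n₁ * n₁ * n₂ * n₂ * ψ * ψ * ζ * w - 4 * x * x * n₁ * n₁ * n₁
        * n₁ * n₂ * n₂ * ψ * ψ * ζ * w * w - 2 * x * x * n₁ * n₁ * n₁ * n₁ * n₂ * n₂ * ψ * ψ * ζ * ζ + 4 * x * x * n₁
        * n₁ * n₁ * n₁ * n₂ * n₂ * ψ * ψ * ζ * ζ * w - 2 * x * x * n₁ * n₁ * n₁ * n₁ * n₂ * n₂ * ψ * ψ * ζ * ζ * w * w := by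
  rw [Matrix.trace_fin_three]
  simp [BFdeg1, Matrix.mul_apply, Fin.sum_univ_three]
  ring

/-- `tr(R¹_{22} R¹_{22})` (a polynomial; generated, kernel-checked). [cite: MagnenRivasseauSeneor1993, §VI (VI.9), (VI.17) pp.370, 373] -/
theorem trDeg1Sq_22 (ζ w ψ x y n₀ n₁ n₂ n₃ : ℝ) :
    Matrix.trace (BFdeg1 ζ w ψ x y n₀ n₁ n₂ n₃ 2 2 * BFdeg1 ζ w ψ x y n₀ n₁ n₂ n₃ 2 2) =
      -2 * y * y * n₂ * n₂ * ψ * ψ + 4 * y * y * n₂ * n₂ * ψ * ψ * w - 2 * y * y * n₂ * n₂ * ψ * ψ * w * w - 4 * y * y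
        * n₂ * n₂ * ψ * ψ * ζ + 4 * y * y * n₂ * n₂ * ψ * ψ * ζ * w * w - 2 * y * y * n₂ * n₂ * ψ * ψ * ζ * ζ - 4 * y
        * y * n₂ * n₂ * ψ * ψ * ζ * ζ * w - 2 * y * y * n₂ * n₂ * ψ * ψ * ζ * ζ * w * w + 4 * y * y * n₂ * n₂ * n₂ *
        n₂ * ψ * ψ - 8 * y * y * n₂ * n₂ * n₂ * n₂ * ψ * ψ * w + 4 * y * y * n₂ * n₂ * n₂ * n₂ * ψ * ψ * w * w + 8 * y
        * y * n₂ * n₂ * n₂ * n₂ * ψ * ψ * ζ - 8 * y * y * n₂ * n₂ * n₂ * n₂ * ψ * ψ * ζ * w + 4 * y * y * n₂ * n₂ * n₂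
        * n₂ * ψ * ψ * ζ * ζ - 4 * y * y * n₂ * n₂ * n₂ * n₂ * ψ * ψ * ζ * ζ * w * w - 2 * y * y * n₂ * n₂ * n₂ * n₂ *
        n₂ * n₂ * ψ * ψ + 4 * y * y * n₂ * n₂ * n₂ * n₂ * n₂ * n₂ * ψ * ψ * w - 2 * y * y * n₂ * n₂ * n₂ * n₂ * n₂ *
        n₂ * ψ * ψ * w * w - 4 * y * y * n₂ * n₂ * n₂ * n₂ * n₂ * n₂ * ψ * ψ * ζ + 8 * y * y * n₂ * n₂ * n₂ * n₂ * n₂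
        * n₂ * ψ * ψ * ζ * w - 4 * y * y * n₂ * n₂ * n₂ * n₂ * n₂ * n₂ * ψ * ψ * ζ * w * w - 2 * y * y * n₂ * n₂ * n₂
        * n₂ * n₂ * n₂ * ψ * ψ * ζ * ζ + 4 * y * y * n₂ * n₂ * n₂ * n₂ * n₂ * n₂ * ψ * ψ * ζ * ζ * w - 2 * y * y * n₂
        * n₂ * n₂ * n₂ * n₂ * n₂ * ψ * ψ * ζ * ζ * w * w - 8 * x * x * n₁ * n₁ * ψ * ψ + 8 * x * x * n₁ * n₁ * n₂ * n₂
        * ψ * ψ - 8 * x * x * n₁ * n₁ * n₂ * n₂ * ψ * ψ * w + 8 * x * x * n₁ * n₁ * n₂ * n₂ * ψ * ψ * ζ - 8 * x * x *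
        n₁ * n₁ * n₂ * n₂ * ψ * ψ * ζ * w - 2 * x * x * n₁ * n₁ * n₂ * n₂ * n₂ * n₂ * ψ * ψ + 4 * x * x * n₁ * n₁ * n₂
        * n₂ * n₂ * n₂ * ψ * ψ * w - 2 * x * x * n₁ * n₁ * n₂ * n₂ * n₂ * n₂ * ψ * ψ * w * w - 4 * x * x * n₁ * n₁ *
        n₂ * n₂ * n₂ * n₂ * ψ * ψ * ζ + 8 * x * x * n₁ * n₁ * n₂ * n₂ * n₂ * n₂ * ψ * ψ * ζ * w - 4 * x * x * n₁ * n₁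
        * n₂ * n₂ * n₂ * n₂ * ψ * ψ * ζ * w * w - 2 * x * x * n₁ * n₁ * n₂ * n₂ * n₂ * n₂ * ψ * ψ * ζ * ζ + 4 * x * x
        * n₁ * n₁ * n₂ * n₂ * n₂ * n₂ * ψ * ψ * ζ * ζ * w - 2 * x * x * n₁ * n₁ * n₂ * n₂ * n₂ * n₂ * ψ * ψ * ζ * ζ *
        w * w := by
  rw [Matrix.trace_fin_three]
  simp [BFdeg1, Matrix.mul_apply, Fin.sum_univ_three]
  ring

/-- `tr(R¹_{23} R¹_{32})` (a polynomial; generated, kernel-checked). [cite: MagnenRivasseauSeneor1993, §VI (VI.9), (VI.17) pp.370, 373] -/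
theorem trDeg1Sq_23 (ζ w ψ x y n₀ n₁ n₂ n₃ : ℝ) :
    Matrix.trace (BFdeg1 ζ w ψ x y n₀ n₁ n₂ n₃ 2 3 * BFdeg1 ζ w ψ x y n₀ n₁ n₂ n₃ 3 2) =
      -2 * y * y * n₃ * n₃ * ψ * ψ * w + 4 * y * y * n₃ * n₃ * ψ * ψ * ζ * w - 2 * y * y * n₃ * n₃ * ψ * ψ * ζ * ζ * w
        - 2 * y * y * n₂ * n₂ * n₃ * n₃ * ψ * ψ + 2 * y * y * n₂ * n₂ * n₃ * n₃ * ψ * ψ * w * w + 2 * y * y * n₂ * n₂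
        * n₃ * n₃ * ψ * ψ * ζ * ζ - 2 * y * y * n₂ * n₂ * n₃ * n₃ * ψ * ψ * ζ * ζ * w * w - 2 * y * y * n₂ * n₂ * n₂ *
        n₂ * n₃ * n₃ * ψ * ψ + 4 * y * y * n₂ * n₂ * n₂ * n₂ * n₃ * n₃ * ψ * ψ * w - 2 * y * y * n₂ * n₂ * n₂ * n₂ *
        n₃ * n₃ * ψ * ψ * w * w - 4 * y * y * n₂ * n₂ * n₂ * n₂ * n₃ * n₃ * ψ * ψ * ζ + 8 * y * y * n₂ * n₂ * n₂ * n₂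
        * n₃ * n₃ * ψ * ψ * ζ * w - 4 * y * y * n₂ * n₂ * n₂ * n₂ * n₃ * n₃ * ψ * ψ * ζ * w * w - 2 * y * y * n₂ * n₂
        * n₂ * n₂ * n₃ * n₃ * ψ * ψ * ζ * ζ + 4 * y * y * n₂ * n₂ * n₂ * n₂ * n₃ * n₃ * ψ * ψ * ζ * ζ * w - 2 * y * y
        * n₂ * n₂ * n₂ * n₂ * n₃ * n₃ * ψ * ψ * ζ * ζ * w * w - 2 * x * x * n₁ * n₁ * n₂ * n₂ * n₃ * n₃ * ψ * ψ + 4 *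
        x * x * n₁ * n₁ * n₂ * n₂ * n₃ * n₃ * ψ * ψ * w - 2 * x * x * n₁ * n₁ * n₂ * n₂ * n₃ * n₃ * ψ * ψ * w * w - 4
        * x * x * n₁ * n₁ * n₂ * n₂ * n₃ * n₃ * ψ * ψ * ζ + 8 * x * x * n₁ * n₁ * n₂ * n₂ * n₃ * n₃ * ψ * ψ * ζ * w -
        4 * x * x * n₁ * n₁ * n₂ * n₂ * n₃ * n₃ * ψ * ψ * ζ * w * w - 2 * x * x * n₁ * n₁ * n₂ * n₂ * n₃ * n₃ * ψ * ψ
        * ζ * ζ + 4 * x * x * n₁ * n₁ * n₂ * n₂ * n₃ * n₃ * ψ * ψ * ζ * ζ * w - 2 * x * x * n₁ * n₁ * n₂ * n₂ * n₃ *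
        n₃ * ψ * ψ * ζ * ζ * w * w := by
  rw [Matrix.trace_fin_three]
  simp [BFdeg1, Matrix.mul_apply, Fin.sum_univ_three]
  ring

/-- `tr(R¹_{30} R¹_{03})` (a polynomial; generated, kernel-checked). [cite: MagnenRivasseauSeneor1993, §VI (VI.9), (VI.17) pp.370, 373] -/
theorem trDeg1Sq_30 (ζ w ψ x y n₀ n₁ n₂ n₃ : ℝ) :
    Matrix.trace (BFdeg1 ζ w ψ x y n₀ n₁ n₂ n₃ 3 0 * BFdeg1 ζ w ψ x y n₀ n₁ n₂ n₃ 0 3) =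
      -2 * y * y * n₀ * n₀ * n₂ * n₂ * n₃ * n₃ * ψ * ψ + 4 * y * y * n₀ * n₀ * n₂ * n₂ * n₃ * n₃ * ψ * ψ * w - 2 * y *
        y * n₀ * n₀ * n₂ * n₂ * n₃ * n₃ * ψ * ψ * w * w - 4 * y * y * n₀ * n₀ * n₂ * n₂ * n₃ * n₃ * ψ * ψ * ζ + 8 * y
        * y * n₀ * n₀ * n₂ * n₂ * n₃ * n₃ * ψ * ψ * ζ * w - 4 * y * y * n₀ * n₀ * n₂ * n₂ * n₃ * n₃ * ψ * ψ * ζ * w *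
        w - 2 * y * y * n₀ * n₀ * n₂ * n₂ * n₃ * n₃ * ψ * ψ * ζ * ζ + 4 * y * y * n₀ * n₀ * n₂ * n₂ * n₃ * n₃ * ψ * ψ
        * ζ * ζ * w - 2 * y * y * n₀ * n₀ * n₂ * n₂ * n₃ * n₃ * ψ * ψ * ζ * ζ * w * w - 2 * x * x * n₀ * n₀ * n₁ * n₁
        * n₃ * n₃ * ψ * ψ + 4 * x * x * n₀ * n₀ * n₁ * n₁ * n₃ * n₃ * ψ * ψ * w - 2 * x * x * n₀ * n₀ * n₁ * n₁ * n₃ *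
        n₃ * ψ * ψ * w * w - 4 * x * x * n₀ * n₀ * n₁ * n₁ * n₃ * n₃ * ψ * ψ * ζ + 8 * x * x * n₀ * n₀ * n₁ * n₁ * n₃
        * n₃ * ψ * ψ * ζ * w - 4 * x * x * n₀ * n₀ * n₁ * n₁ * n₃ * n₃ * ψ * ψ * ζ * w * w - 2 * x * x * n₀ * n₀ * n₁
        * n₁ * n₃ * n₃ * ψ * ψ * ζ * ζ + 4 * x * x * n₀ * n₀ * n₁ * n₁ * n₃ * n₃ * ψ * ψ * ζ * ζ * w - 2 * x * x * n₀
        * n₀ * n₁ * n₁ * n₃ * n₃ * ψ * ψ * ζ * ζ * w * w := by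
  rw [Matrix.trace_fin_three]
  simp [BFdeg1, Matrix.mul_apply, Fin.sum_univ_three]
  ring

/-- `tr(R¹_{31} R¹_{13})` (a polynomial; generated, kernel-checked). [cite: MagnenRivasseauSeneor1993, §VI (VI.9), (VI.17) pp.370, 373] -/
theorem trDeg1Sq_31 (ζ w ψ x y n₀ n₁ n₂ n₃ : ℝ) :
    Matrix.trace (BFdeg1 ζ w ψ x y n₀ n₁ n₂ n₃ 3 1 * BFdeg1 ζ w ψ x y n₀ n₁ n₂ n₃ 1 3) =
      -2 * y * y * n₁ * n₁ * n₂ * n₂ * n₃ * n₃ * ψ * ψ + 4 * y * y * n₁ * n₁ * n₂ * n₂ * n₃ * n₃ * ψ * ψ * w - 2 * y *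
        y * n₁ * n₁ * n₂ * n₂ * n₃ * n₃ * ψ * ψ * w * w - 4 * y * y * n₁ * n₁ * n₂ * n₂ * n₃ * n₃ * ψ * ψ * ζ + 8 * y
        * y * n₁ * n₁ * n₂ * n₂ * n₃ * n₃ * ψ * ψ * ζ * w - 4 * y * y * n₁ * n₁ * n₂ * n₂ * n₃ * n₃ * ψ * ψ * ζ * w *
        w - 2 * y * y * n₁ * n₁ * n₂ * n₂ * n₃ * n₃ * ψ * ψ * ζ * ζ + 4 * y * y * n₁ * n₁ * n₂ * n₂ * n₃ * n₃ * ψ * ψ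
        * ζ * ζ * w - 2 * y * y * n₁ * n₁ * n₂ * n₂ * n₃ * n₃ * ψ * ψ * ζ * ζ * w * w - 2 * x * x * n₃ * n₃ * ψ * ψ *
        w + 4 * x * x * n₃ * n₃ * ψ * ψ * ζ * w - 2 * x * x * n₃ * n₃ * ψ * ψ * ζ * ζ * w - 2 * x * x * n₁ * n₁ * n₃ *
        n₃ * ψ * ψ + 2 * x * x * n₁ * n₁ * n₃ * n₃ * ψ * ψ * w * w + 2 * x * x * n₁ * n₁ * n₃ * n₃ * ψ * ψ * ζ * ζ - 2
        * x * x * n₁ * n₁ * n₃ * n₃ * ψ * ψ * ζ * ζ * w * w - 2 * x * x * n₁ * n₁ * n₁ * n₁ * n₃ * n₃ * ψ * ψ + 4 * x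
        * x * n₁ * n₁ * n₁ * n₁ * n₃ * n₃ * ψ * ψ * w - 2 * x * x * n₁ * n₁ * n₁ * n₁ * n₃ * n₃ * ψ * ψ * w * w - 4 *
        x * x * n₁ * n₁ * n₁ * n₁ * n₃ * n₃ * ψ * ψ * ζ + 8 * x * x * n₁ * n₁ * n₁ * n₁ * n₃ * n₃ * ψ * ψ * ζ * w - 4
        * x * x * n₁ * n₁ * n₁ * n₁ * n₃ * n₃ * ψ * ψ * ζ * w * w - 2 * x * x * n₁ * n₁ * n₁ * n₁ * n₃ * n₃ * ψ * ψ *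
        ζ * ζ + 4 * x * x * n₁ * n₁ * n₁ * n₁ * n₃ * n₃ * ψ * ψ * ζ * ζ * w - 2 * x * x * n₁ * n₁ * n₁ * n₁ * n₃ * n₃
        * ψ * ψ * ζ * ζ * w * w := by
  rw [Matrix.trace_fin_three]
  simp [BFdeg1, Matrix.mul_apply, Fin.sum_univ_three]
  ring

/-- `tr(R¹_{32} R¹_{23})` (a polynomial; generated, kernel-checked). [cite: MagnenRivasseauSeneor1993, §VI (VI.9), (VI.17) pp.370, 373] -/
theorem trDeg1Sq_32 (ζ w ψ x y n₀ n₁ n₂ n₃ : ℝ) :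
    Matrix.trace (BFdeg1 ζ w ψ x y n₀ n₁ n₂ n₃ 3 2 * BFdeg1 ζ w ψ x y n₀ n₁ n₂ n₃ 2 3) =
      -2 * y * y * n₃ * n₃ * ψ * ψ * w + 4 * y * y * n₃ * n₃ * ψ * ψ * ζ * w - 2 * y * y * n₃ * n₃ * ψ * ψ * ζ * ζ * w
        - 2 * y * y * n₂ * n₂ * n₃ * n₃ * ψ * ψ + 2 * y * y * n₂ * n₂ * n₃ * n₃ * ψ * ψ * w * w + 2 * y * y * n₂ * n₂
        * n₃ * n₃ * ψ * ψ * ζ * ζ - 2 * y * y * n₂ * n₂ * n₃ * n₃ * ψ * ψ * ζ * ζ * w * w - 2 * y * y * n₂ * n₂ * n₂ *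
        n₂ * n₃ * n₃ * ψ * ψ + 4 * y * y * n₂ * n₂ * n₂ * n₂ * n₃ * n₃ * ψ * ψ * w - 2 * y * y * n₂ * n₂ * n₂ * n₂ *
        n₃ * n₃ * ψ * ψ * w * w - 4 * y * y * n₂ * n₂ * n₂ * n₂ * n₃ * n₃ * ψ * ψ * ζ + 8 * y * y * n₂ * n₂ * n₂ * n₂
        * n₃ * n₃ * ψ * ψ * ζ * w - 4 * y * y * n₂ * n₂ * n₂ * n₂ * n₃ * n₃ * ψ * ψ * ζ * w * w - 2 * y * y * n₂ * n₂
        * n₂ * n₂ * n₃ * n₃ * ψ * ψ * ζ * ζ + 4 * y * y * n₂ * n₂ * n₂ * n₂ * n₃ * n₃ * ψ * ψ * ζ * ζ * w - 2 * y * y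
        * n₂ * n₂ * n₂ * n₂ * n₃ * n₃ * ψ * ψ * ζ * ζ * w * w - 2 * x * x * n₁ * n₁ * n₂ * n₂ * n₃ * n₃ * ψ * ψ + 4 *
        x * x * n₁ * n₁ * n₂ * n₂ * n₃ * n₃ * ψ * ψ * w - 2 * x * x * n₁ * n₁ * n₂ * n₂ * n₃ * n₃ * ψ * ψ * w * w - 4
        * x * x * n₁ * n₁ * n₂ * n₂ * n₃ * n₃ * ψ * ψ * ζ + 8 * x * x * n₁ * n₁ * n₂ * n₂ * n₃ * n₃ * ψ * ψ * ζ * w -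
        4 * x * x * n₁ * n₁ * n₂ * n₂ * n₃ * n₃ * ψ * ψ * ζ * w * w - 2 * x * x * n₁ * n₁ * n₂ * n₂ * n₃ * n₃ * ψ * ψ
        * ζ * ζ + 4 * x * x * n₁ * n₁ * n₂ * n₂ * n₃ * n₃ * ψ * ψ * ζ * ζ * w - 2 * x * x * n₁ * n₁ * n₂ * n₂ * n₃ *
        n₃ * ψ * ψ * ζ * ζ * w * w := by
  rw [Matrix.trace_fin_three]
  simp [BFdeg1, Matrix.mul_apply, Fin.sum_univ_three]
  ring

/-- `tr(R¹_{33} R¹_{33})` (a polynomial; generated, kernel-checked). [cite: MagnenRivasseauSeneor1993, §VI (VI.9), (VI.17) pp.370, 373] -/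
theorem trDeg1Sq_33 (ζ w ψ x y n₀ n₁ n₂ n₃ : ℝ) :
    Matrix.trace (BFdeg1 ζ w ψ x y n₀ n₁ n₂ n₃ 3 3 * BFdeg1 ζ w ψ x y n₀ n₁ n₂ n₃ 3 3) =
      -8 * y * y * n₂ * n₂ * ψ * ψ + 8 * y * y * n₂ * n₂ * n₃ * n₃ * ψ * ψ - 8 * y * y * n₂ * n₂ * n₃ * n₃ * ψ * ψ * w
        + 8 * y * y * n₂ * n₂ * n₃ * n₃ * ψ * ψ * ζ - 8 * y * y * n₂ * n₂ * n₃ * n₃ * ψ * ψ * ζ * w - 2 * y * y * n₂ *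
        n₂ * n₃ * n₃ * n₃ * n₃ * ψ * ψ + 4 * y * y * n₂ * n₂ * n₃ * n₃ * n₃ * n₃ * ψ * ψ * w - 2 * y * y * n₂ * n₂ *
        n₃ * n₃ * n₃ * n₃ * ψ * ψ * w * w - 4 * y * y * n₂ * n₂ * n₃ * n₃ * n₃ * n₃ * ψ * ψ * ζ + 8 * y * y * n₂ * n₂
        * n₃ * n₃ * n₃ * n₃ * ψ * ψ * ζ * w - 4 * y * y * n₂ * n₂ * n₃ * n₃ * n₃ * n₃ * ψ * ψ * ζ * w * w - 2 * y * y
        * n₂ * n₂ * n₃ * n₃ * n₃ * n₃ * ψ * ψ * ζ * ζ + 4 * y * y * n₂ * n₂ * n₃ * n₃ * n₃ * n₃ * ψ * ψ * ζ * ζ * w -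
        2 * y * y * n₂ * n₂ * n₃ * n₃ * n₃ * n₃ * ψ * ψ * ζ * ζ * w * w - 8 * x * x * n₁ * n₁ * ψ * ψ + 8 * x * x * n₁
        * n₁ * n₃ * n₃ * ψ * ψ - 8 * x * x * n₁ * n₁ * n₃ * n₃ * ψ * ψ * w + 8 * x * x * n₁ * n₁ * n₃ * n₃ * ψ * ψ * ζ
        - 8 * x * x * n₁ * n₁ * n₃ * n₃ * ψ * ψ * ζ * w - 2 * x * x * n₁ * n₁ * n₃ * n₃ * n₃ * n₃ * ψ * ψ + 4 * x * x
        * n₁ * n₁ * n₃ * n₃ * n₃ * n₃ * ψ * ψ * w - 2 * x * x * n₁ * n₁ * n₃ * n₃ * n₃ * n₃ * ψ * ψ * w * w - 4 * x *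
        x * n₁ * n₁ * n₃ * n₃ * n₃ * n₃ * ψ * ψ * ζ + 8 * x * x * n₁ * n₁ * n₃ * n₃ * n₃ * n₃ * ψ * ψ * ζ * w - 4 * x
        * x * n₁ * n₁ * n₃ * n₃ * n₃ * n₃ * ψ * ψ * ζ * w * w - 2 * x * x * n₁ * n₁ * n₃ * n₃ * n₃ * n₃ * ψ * ψ * ζ *
        ζ + 4 * x * x * n₁ * n₁ * n₃ * n₃ * n₃ * n₃ * ψ * ψ * ζ * ζ * w - 2 * x * x * n₁ * n₁ * n₃ * n₃ * n₃ * n₃ * ψ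
        * ψ * ζ * ζ * w * w := by
  rw [Matrix.trace_fin_three]
  simp [BFdeg1, Matrix.mul_apply, Fin.sum_univ_three]
  ring

/-- **On the momentum sphere the first order is affine in `A = n₁²x² + n₂²y²`** (`= x²[cos²θ + t²sin²θcos²φ]` in the variables of p.372,
`y = tx`, `n₁ = cosθ`, `n₂ = sinθcosφ`): `lnDetFirstOrder = α(x² + y²) + γ(n₁²x² + n₂²y²)` with `α, γ` the explicit polynomials in `ψ, ζ, w`
below (free `w`; the sphere relation eliminates `n₀, n₃`). For `w = ζ⁻¹`: `α = ψ(4 + 2ζ⁻¹ + 2ζ) + ψ²(4 − 2ζ⁻¹ − 2ζ)`,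
`γ = ψ(4 − 2ζ⁻¹ − 2ζ) + ψ²(−20 + 2ζ⁻¹ + 2ζ)`. [cite: MagnenRivasseauSeneor1993, §VI (VI.17) p.373] -/
theorem lnDetFirstOrder_sphere {n₀ n₁ n₂ n₃ : ℝ} (hn : n₀ ^ 2 + n₁ ^ 2 + n₂ ^ 2 + n₃ ^ 2 = 1) (ζ w ψ x y : ℝ) :
    lnDetFirstOrder ζ w ψ x y n₀ n₁ n₂ n₃ =
      (4 * ψ + 2 * ψ * w + 2 * ψ * ζ - 2 * ψ ^ 2 * w + 4 * ψ ^ 2 * ζ * w - 2 * ψ ^ 2 * ζ ^ 2 * w) * (x ^ 2 + y ^ 2) +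
        (2 * ψ - 2 * ψ * w - 2 * ψ * ζ + 2 * ψ * ζ * w - 12 * ψ ^ 2 + 2 * ψ ^ 2 * w - 4 * ψ ^ 2 * ζ * w + 2 * ψ ^ 2 * ζ ^ 2 * w - 4 * ψ ^ 2 * ζ ^ 2 * w ^ 2) *
          (n₁ ^ 2 * x ^ 2 + n₂ ^ 2 * y ^ 2) := by
  unfold lnDetFirstOrder
  simp only [Fin.sum_univ_four]
  rw [trDeg2_0, trDeg2_1, trDeg2_2, trDeg2_3]
  rw [trDeg1Sq_00, trDeg1Sq_01, trDeg1Sq_02, trDeg1Sq_03, trDeg1Sq_10, trDeg1Sq_11, trDeg1Sq_12, trDeg1Sq_13]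
  rw [trDeg1Sq_20, trDeg1Sq_21, trDeg1Sq_22, trDeg1Sq_23, trDeg1Sq_30, trDeg1Sq_31, trDeg1Sq_32, trDeg1Sq_33]
  linear_combination
    ((x ^ 2 + y ^ 2) * (-2 * ψ * (1 - w) - 2 * ψ ^ 2 * w * (1 - ζ) ^ 2) +
      (n₁ ^ 2 * x ^ 2 + n₂ ^ 2 * y ^ 2) * ψ ^ 2 *
        ((1 - 2 * w + w ^ 2 + 2 * ζ - 2 * ζ * w ^ 2 + ζ ^ 2 + 2 * ζ ^ 2 * w - 3 * ζ ^ 2 * w ^ 2) -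
          (1 + ζ) ^ 2 * (1 - w) ^ 2 * (n₀ ^ 2 + n₁ ^ 2 + n₂ ^ 2 + n₃ ^ 2))) * hn

/-- **(VI.17), kernel-checked for every ζ.** For `ζ ≠ 0`, `w = ζ⁻¹`, on the momentum sphere in the variables of p.372 (`y = tx`,
`n₁ = p₁/p = cosθ`, `n₂ = p₂/p = sinθcosφ`; `n₀, n₃` do not enter, `lnDetFirstOrder_sphere`), minus one half of the angular average
`angAvg = (2/π)∫₀^π sin²θ dθ (1/2)∫₀^π sinφ dφ` of the first order of `ln det BF` is
`ψx² · ½(1 + t²) · [−6(1 + (1/ζ − 1)/4) − 2ζ(1 + (1/ζ − 1)/4) + κ((9/2) + (3/2)(1/ζ − 1) − 2 + (3/2)ζ)]` with `κ = ψ` on `|p| = 1`, i.e.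
`(β/2)(1 + t²)·OneLoop.bosonFirstOrder ζ κ` with `β = ψx²` — the right-hand side of (VI.17) AS PRINTED: «[(2/π)∫₀^{+π} sin²θdθ(1/2)∫₀^{+π}
sinφdφ − (1/2)ln(1 + βP, κ, t, cosθ, sinφ, ζ, 1/ζ)) [sic: read ln(1 + βP(β, κ, t, cosθ, sinφ, ζ, 1/ζ)), as (VI.18) prints it]]
= (β/2)(1 + t²)(−6(1 + (1/ζ − 1)/4) − 2ζ(1 + (1/ζ − 1)/4) + κ[(9/2) + (3/2)(1/ζ − 1) − 2 + (3/2)ζ]) + O(β²). (VI.17)» (p.373). The analytic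
step `ln det(1 + M) = tr M − ½tr M² + O(‖M‖³)` is the paper's («tracing the twelve by twelve matrix (VI.9) and its square», tl.17–18) and
is not re-proved here. [cite: MagnenRivasseauSeneor1993, §VI (VI.17) p.373] -/
theorem bosonFirstOrder_VI17 {ζ : ℝ} (hζ : ζ ≠ 0) (ψ x t : ℝ) :
    -(1 / 2) * angAvg (fun θ φ =>
        lnDetFirstOrder ζ ζ⁻¹ ψ x (t * x) 0 (Real.cos θ) (Real.sin θ * Real.cos φ) (Real.sin θ * Real.sin φ)) =
      ψ * x ^ 2 * (1 / 2 * (1 + t ^ 2) * OneLoop.bosonFirstOrder ζ ψ) := by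
  have hsph : ∀ θ φ : ℝ,
      (0 : ℝ) ^ 2 + Real.cos θ ^ 2 + (Real.sin θ * Real.cos φ) ^ 2 + (Real.sin θ * Real.sin φ) ^ 2 = 1 := by
    intro θ φ
    nlinarith [Real.cos_sq_add_sin_sq θ, Real.cos_sq_add_sin_sq φ]
  have hfun : (fun θ φ => lnDetFirstOrder ζ ζ⁻¹ ψ x (t * x) 0 (Real.cos θ) (Real.sin θ * Real.cos φ) (Real.sin θ * Real.sin φ)) =
      fun θ φ => (4 * ψ + 2 * ψ * ζ⁻¹ + 2 * ψ * ζ - 2 * ψ ^ 2 * ζ⁻¹ + 4 * ψ ^ 2 * ζ * ζ⁻¹ - 2 * ψ ^ 2 * ζ ^ 2 * ζ⁻¹) * (x ^ 2 + (t * x) ^ 2) +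
        (2 * ψ - 2 * ψ * ζ⁻¹ - 2 * ψ * ζ + 2 * ψ * ζ * ζ⁻¹ - 12 * ψ ^ 2 + 2 * ψ ^ 2 * ζ⁻¹ - 4 * ψ ^ 2 * ζ * ζ⁻¹ + 2 * ψ ^ 2 * ζ ^ 2 * ζ⁻¹ - 4 * ψ ^ 2 * ζ ^ 2 * ζ⁻¹ ^ 2) * x ^ 2 *
          (Real.cos θ ^ 2 + t ^ 2 * Real.sin θ ^ 2 * Real.cos φ ^ 2) := by
    funext θ φ
    rw [lnDetFirstOrder_sphere (hsph θ φ)]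
    ring
  rw [hfun, angAvg_affine_A]
  unfold OneLoop.bosonFirstOrder
  field_simp
  ring

/-- The same at the homothetic gauge `ζ = 3/13` of the construction («closest to 1/4 … ζ = 3/13», p.374 tl.4–5). [cite: MagnenRivasseauSeneor1993, §VI (VI.17)–(VI.19) pp.373–374] -/
theorem bosonFirstOrder_VI17_homothetic (ψ x t : ℝ) :
    -(1 / 2) * angAvg (fun θ φ =>
        lnDetFirstOrder (3 / 13) (3 / 13)⁻¹ ψ x (t * x) 0 (Real.cos θ) (Real.sin θ * Real.cos φ) (Real.sin θ * Real.sin φ)) =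
      ψ * x ^ 2 * (1 / 2 * (1 + t ^ 2) * OneLoop.bosonFirstOrder (3 / 13) ψ) :=
  bosonFirstOrder_VI17 (by norm_num) ψ x t

end BosonTrace

end Literature.MathematicalPhysics.QuantumFieldTheory.MagnenRivasseauSeneor1993
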